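import Literature.Probability.RandomPlanarGeometry.HexSAWBrickWallStripFugacityWidthOneSeries
import Literature.Probability.RandomPlanarGeometry.HexSAWBrickWallStripFugacityWidthOneSexticLaw
import Mathlib.Analysis.SpecificLimits.Normed
import Mathlib.Analysis.Complex.Polynomial.Basic
import Mathlib.Tactic
import HarnessLib

/-!
# The parity-resolved amplitudes of the two-fugacity one-cell honeycomb strip:
# `C_{1,2M+c}(y,z) / μ_1(y,z)^{2M+c} → A_c(y,z)` (`c = 0, 1`) for all fugacities `y, z > 0`, with `A_0, A_1` explicit

Topic `Literature/Probability/RandomPlanarGeometry` (continues `HexSAWBrickWallStripFugacityWidthOneSeries.lean`: the rational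
two-fugacity walk series `Σ_N C_{1,N}(y,z) x^N = P(x;y,z)/(q(x²)(1 − yzx⁴)²)`, `q(u) = (1−yu)(1−zu) − yzu³`, of the width-one
row strip `S_1 = ℤ × {0,1}` of the brick-wall (= honeycomb) lattice with site fugacities `y, z` on the two rows
(`C_{1,N}(y,z) = HexBW.stripZ₂ 1 N y z`, `stripZ₂_one_series`); `HexSAWBrickWallStripFugacityWidthOneSexticLaw.lean`: the growth
rate `μ = μ_1(y,z) = stripMuY₂ 1 y z` satisfies THE SEXTIC LAW `s(s − y)(s − z) = yz`, `s = μ²` (`stripMuY₂_one_sq_poly_eq`) with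
`max(y,z) < s` (`max_lt_stripMuY₂_one_sq`); and the two amplitude files `HexSAWBrickWallStripWidthOneAmplitude.lean` (`y = z = 1`)
and `HexSAWBrickWallStripFugacityWidthOneAmplitude.lean` (`z = y`)).

THE GENERAL CASE `y ≠ z` HAS A NEW FEATURE: the reciprocal growth rate enters the denominator only through `q(x²)`, so BOTH
`x = ±μ^{-1}` are dominant poles and `C_{1,N}(y,z)/μ^N` does NOT converge — it has two limit points, one along even and one
along odd `N` (`γ = 1` with a PARITY-DEPENDENT amplitude; for equal walls the numerator kills the pole at `−μ^{-1}` and the two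
merge).  This file computes both amplitudes in closed form for ALL `y, z > 0`:

  ★★★ `tendsto_stripZ₂_one_even_div_pow`: `C_{1,2M}(y,z)/μ^{2M} → A₀(y,z) = s(U₀s² + U₂s + U₄)/(d·D₂)`,
  ★★★ `tendsto_stripZ₂_one_odd_div_pow`:  `C_{1,2M+1}(y,z)/μ^{2M+1} → A₁(y,z) = s(U₁s² + U₃s + U₅)/(d·μ·D₂)`,
      where `s = μ_1(y,z)²`, `d = ((y − z)² + 2y + 2z + 1)²`, `D₂ = (y+z)s² − 2yz·s + 3yz`, and `U₀, …, U₅ ∈ ℤ[y,z]` are the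
      coefficients of the numerator `U(X)` over `q(X²)` in the partial-fraction decomposition below (printed in the statements;
      e.g. `U₀ = 4 + 46z + 58z² + 28z³ + 14z⁴ + 2z⁵ + 46y + 80yz + 44yz² − 4yz³ − 6yz⁴ + 58y² + 44y²z − 20y²z² + 4y²z³ + 28y³
      − 4y³z + 4y³z² + 14y⁴ − 6y⁴z + 2y⁵`);  numerically `(y,z) = (2,1)`: `μ ≈ 1.58789`, `A₀ ≈ 18.8419 ≠ A₁ ≈ 18.2135`;
      `(1,1)`: `A₀ = A₁ ≈ 17.2335` (the plain amplitude); `(½,½)`: `μ = 1`, `A₀ = A₁ = 64/5`;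
  ★★ `exists_stripZ₂_one_parity_amplitudes` (`∃ A₀, A₁ > 0` with the two limits — the clean qualitative form),
     `pos_of_tendsto_stripZ₂_one_parity` (positivity from Fekete: `μ^N ≤ K(y)K(z)C_{1,N}`, `stripMuY₂_one_pow_le`);
  ★★ `tendsto_stripZ₂_one_ratio_two`: `C_{1,N+2}(y,z)/C_{1,N}(y,z) → μ_1(y,z)²` for all `y, z > 0` (the two-step ratio law;
     the one-step ratio oscillates when `A₀ ≠ A₁`);
  ★★ `not_tendsto_stripZ₂_one_two_one`: at `(y,z) = (2,1)` the sequence `C_{1,N}/μ^N` has NO limit (`A₀(2,1) > A₁(2,1)`, certified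
     from `2.521 < s < 2.522`) — `γ = 1` parity by parity, but the form `c_N ∼ Aμ^N` fails for unequal walls;
  ★★ `tendsto_stripZ₀_one_even_div_pow` / `tendsto_stripZ₀_one_odd_div_pow`: the ONE-ATTRACTIVE-WALL specialisation `z = 1`
     in the tree's own vocabulary (`stripZ₀ 1 N y = C_{1,N}(y,1)`, `stripMuY₀ 1 y = μ_1(y,1)` of Proposition 7), with the
     univariate `U_j(y,1)` and `d = (y² + 4)²` written out;
  ★ `tendsto_stripZ₂_one_parity_of_decomposition` (THE CORE: any decomposition `d·P = E·q(X²)Q² + U·Q² + V·q(X²)` with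
     `deg E ≤ 1, deg U ≤ 5, deg V ≤ 7` yields the parity limits in terms of `[X^k] U/q(X²)`), and the generic tools
  ★ `norm_lt_one_of_schurCohn` (Schur–Cohn for `σ² + pσ + κ`: `|κ| < 1`, `|p| < 1 + κ` ⇒ all complex roots in the open unit disc),
  ★ `tendsto_zero_of_rec_two_schurCohn` (`w_{n+2} = −p w_{n+1} − κ w_n ⇒ w → 0`, by complex deflation),
  ★ `tendsto_div_pow_of_cubic_rec₃` (UNIFORM BINET FOR A REAL CUBIC `t³ = at² + bt + c` with positive dominant root `s`:
     `u_n/sⁿ → (s u_2 + s(s − a)u_1 + c u_0)/(s P′(s))` whenever `0 ≤ a`, `0 < c < s³`, `(a − s)s² < s³ + c`),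
  `tendsto_div_pow_zero_of_rec_eight_sq`, `stripMuY₂_one_pow_le`.

## The argument

(1) PARTIAL FRACTIONS OVER `ℚ(y,z)` (found by exact linear algebra — `kit/pf3.py` — and verified here by ONE `ring` identity):
`d·P(X;y,z) = E·q(X²)(1−yzX⁴)² + U·(1−yzX⁴)² + V·q(X²)` with `d = ((y−z)² + 2y + 2z + 1)²` — the square of
`Res_u(q, 1 − yz u²)/(yz)² = (y+z+1)² − 4yz > 0` — and `E, U, V ∈ ℤ[y,z][X]` of `X`-degrees `1, 5, 7` (all sixteen coefficient
polynomials are written out in the proof as local constants).  Hence `d·Σ C_{1,N}X^N = E + U/q(X²) + V/(1−yzX⁴)²` in `ℝ⟦X⟧`.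
(2) PARITY SUBSEQUENCES.  `u_N = [X^N]U/q(X²)` obeys `u_{N+6} = (y+z)u_{N+4} − yz u_{N+2} + yz u_N`, so for each `c` the
subsequence `b_M = u_{2M+c}` obeys the cubic recurrence with characteristic polynomial `t(t−y)(t−z) − yz`, whose positive root is
`s = μ²` by the sextic law; the cofactor is Schur–Cohn stable for ALL `y, z > 0` (`yz < s³` and `(y+z−s)s² < s³ + yz`, i.e.
`y(s−z)² + z(s² − yz) + 3yz > 0`), whether its two roots are real (large fugacities) or complex — so
`tendsto_div_pow_of_cubic_rec₃` applies uniformly.  `e_N = [X^N]V/(1−yzX⁴)²` is `O(N (yz)^{N/4}) = o(μ^N)` since `yz < s²`.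
(3) The residue form: `s·u_{c+4} + s(s−y−z)u_{c+2} + yz·u_c = s(U_c s² + U_{c+2} s + U_{c+4})` and `s·P′(s) = D₂` modulo the
sextic law (two `linear_combination`s).

Sources.  N. R. Beaton, M. Bousquet-Mélou, J. de Gier, H. Duminil-Copin, A. J. Guttmann, CMP 326 (2014), arXiv:1109.0358v5 §3.2
(p. 10: the strips `S_T` with wall fugacities, `C_{T,N}(y,z)`, Proposition 6: `μ_T(y,z)`; p. 12: the strip series are
rational); N. Madras, G. Slade, *The Self-Avoiding Walk* (1993), §1.1 eq. (1.1.4) p. 5 (`c_N ∼ Aμ^N N^{γ−1}`), §8.5 Notes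
pp. 278–279 (`γ(R) = 1` for one-dimensional lattices: Klein 1980, Alm–Janson 1990); S. E. Alm, S. Janson, Commun. Statist.
Stochastic Models 6 (1990) 169–212 (the general theorem; no amplitudes for this model are printed); R. P. Stanley, *Enumerative
Combinatorics* 1 (2nd ed.), §4.1 Theorem 4.1.1 (iii).  The parity-dependent amplitudes `A₀, A₁` and their closed forms are not in
print; they are derived here from the tree's rational series and sextic law.

## Statements (namespace `Literature.Probability.RandomPlanarGeometry.SAW.HexBW.WidthOneYZ`, all PROVED, standard axioms; no
new definition)

§C1 `norm_lt_one_of_schurCohn`, `tendsto_zero_of_rec_two_schurCohn`, ★ `tendsto_div_pow_of_cubic_rec₃`.  §C2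
`tendsto_div_pow_zero_of_rec_eight_sq` (+ private `tendsto_zero_of_residues`).  §C3 private `coeff_rec_six`, `coeff_init_six`,
`coeff_rec_eight_yz`.  §C4 `stripMuY₂_one_pow_le`, ★ `tendsto_stripZ₂_one_parity_of_decomposition`.  §C5
★★★ `tendsto_stripZ₂_one_even_div_pow`, ★★★ `tendsto_stripZ₂_one_odd_div_pow`, `pos_of_tendsto_stripZ₂_one_parity`,
★★ `exists_stripZ₂_one_parity_amplitudes`, ★★ `tendsto_stripZ₂_one_ratio_two` (+ private `ratio_two_of_parity_limit`),
★★ `not_tendsto_stripZ₂_one_two_one`, ★★ `tendsto_stripZ₀_one_even_div_pow`, `tendsto_stripZ₀_one_odd_div_pow`.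
-/

noncomputable section

open Filter Topology Asymptotics PowerSeries

namespace Literature.Probability.RandomPlanarGeometry.SAW.HexBW

namespace WidthOneYZ

section schurCohn

/-! ## §C1 Schur–Cohn and a uniform Binet lemma for real cubics -/

/-- Schur–Cohn for a real monic quadratic: if `|κ| < 1` and `|p| < 1 + κ` then every complex root of `σ² + pσ + κ = 0`
lies in the open unit disc. [cite: Stanley2012EC1, §4.1 (Theorem 4.1.1 (iii): the growth of the coefficients is governed by the reciprocal roots)] -/
theorem norm_lt_one_of_schurCohn {p κ : ℝ} (hκ : |κ| < 1) (hp : |p| < 1 + κ) {σ : ℂ}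
    (h : σ ^ 2 + p * σ + κ = 0) : ‖σ‖ < 1 := by
  rw [abs_lt] at hκ hp
  set a := σ.re with ha
  set b := σ.im with hb
  have hre : a * a - b * b + p * a + κ = 0 := by
    have := congrArg Complex.re h
    simpa [sq, Complex.mul_re, Complex.add_re] using this
  have him : a * b + b * a + p * b = 0 := by
    have := congrArg Complex.im h
    simpa [sq, Complex.mul_im, Complex.add_im] using this
  have hnorm : ‖σ‖ ^ 2 = a * a + b * b := by rw [Complex.sq_norm, Complex.normSq_apply]
  have key : a * a + b * b < 1 := by
    by_cases hb0 : b = 0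
    · -- real root
      rw [hb0] at hre
      simp only [mul_zero, sub_zero] at hre
      rw [hb0, mul_zero, add_zero]
      by_contra hge
      rw [not_lt] at hge
      rcases le_or_gt 0 a with ha0 | ha0
      · -- `a ≥ 1`: `a² + pa + κ > (a-1)(a-κ) ≥ 0`
        have ha1 : 1 ≤ a := by nlinarith
        nlinarith [mul_nonneg (sub_nonneg.2 ha1) (by linarith : 0 ≤ a - κ)]
      · have ha1 : a ≤ -1 := by nlinarith
        nlinarith [mul_nonneg (neg_nonneg.2 (by linarith : a + 1 ≤ 0)) (neg_nonneg.2 (by linarith : a + κ ≤ 0))]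
    · -- non-real root: `a = -p/2`, `a² + b² = κ`
      have h2a : 2 * a + p = 0 := by
        have : b * (2 * a + p) = 0 := by linear_combination him
        rcases mul_eq_zero.1 this with h | h
        · exact absurd h hb0
        · exact h
      nlinarith
  have : ‖σ‖ ^ 2 < 1 := by rw [hnorm]; exact key
  nlinarith [norm_nonneg σ]

/-- Every real solution of `w_{n+2} = −p w_{n+1} − κ w_n` with `0 < κ < 1`, `|p| < 1 + κ` tends to `0` (complex deflation; no
case distinction at the double root `p² = 4κ`). [cite: Stanley2012EC1, §4.1 (Theorem 4.1.1 (iii))] -/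
theorem tendsto_zero_of_rec_two_schurCohn {p κ : ℝ} (hκ0 : 0 < κ) (hκ1 : κ < 1) (hp : |p| < 1 + κ) {w : ℕ → ℝ}
    (hw : ∀ n, w (n + 2) = -p * w (n + 1) - κ * w n) : Tendsto w atTop (𝓝 0) := by
  have hκ : |κ| < 1 := by rw [abs_lt]; constructor <;> linarith
  obtain ⟨c, hc⟩ := IsAlgClosed.exists_pow_nat_eq ((p : ℂ) ^ 2 - 4 * (κ : ℂ)) (by norm_num : 0 < 2)
  set σ₁ : ℂ := (-p + c) / 2 with hσ₁
  set σ₂ : ℂ := (-p - c) / 2 with hσ₂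
  have hsum : σ₂ = -p - σ₁ := by rw [hσ₁, hσ₂]; ring
  have hprod : σ₁ * σ₂ = κ := by
    rw [hσ₁, hσ₂]; linear_combination (-1 / 4 : ℂ) * hc
  have hq1 : σ₁ ^ 2 + p * σ₁ + κ = 0 := by rw [← hprod, hsum]; ring
  have hq2 : σ₂ ^ 2 + p * σ₂ + κ = 0 := by rw [← hprod, hsum]; ring
  have hn1 := norm_lt_one_of_schurCohn hκ hp hq1
  have hn2 := norm_lt_one_of_schurCohn hκ hp hq2
  set r : ℝ := max ‖σ₁‖ ‖σ₂‖ with hr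
  have hr0 : 0 ≤ r := le_max_of_le_left (norm_nonneg _)
  have hr1 : r < 1 := max_lt hn1 hn2
  set W : ℕ → ℂ := fun n => (w n : ℂ) with hW
  have hWrec : ∀ n, W (n + 2) = -(p : ℂ) * W (n + 1) - (κ : ℂ) * W n := by
    intro n; simp only [hW, hw n]; push_cast; ring
  set g : ℕ → ℂ := fun n => W (n + 1) - σ₁ * W n with hg
  have hgrec : ∀ n, g (n + 1) = σ₂ * g n := by
    intro n
    simp only [hg]
    rw [show n + 1 + 1 = n + 2 by omega, hWrec n, hsum]
    linear_combination (-(W n)) * hprod - (W n / 2) * hc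
  have hgn : ∀ n, g n = σ₂ ^ n * g 0 := by
    intro n
    induction n with
    | zero => simp
    | succ n ih => rw [hgrec, ih]; ring
  have hbound : ∀ n : ℕ, ‖W (n + 1)‖ ≤ r ^ (n + 1) * ‖W 0‖ + ((n : ℝ) + 1) * r ^ n * ‖g 0‖ := by
    intro n
    induction n with
    | zero =>
      have e : W (0 + 1) = σ₁ * W 0 + g 0 := by simp only [hg]; ring
      rw [e]
      simp only [zero_add, pow_one, pow_zero, Nat.cast_zero, one_mul, mul_one]
      calc ‖σ₁ * W 0 + g 0‖ ≤ ‖σ₁ * W 0‖ + ‖g 0‖ := norm_add_le _ _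
        _ = ‖σ₁‖ * ‖W 0‖ + ‖g 0‖ := by rw [norm_mul]
        _ ≤ r * ‖W 0‖ + ‖g 0‖ := by
          have : ‖σ₁‖ ≤ r := le_max_left _ _
          have h0 : 0 ≤ ‖W 0‖ := norm_nonneg _
          nlinarith
    | succ n ih =>
      have e : W (n + 1 + 1) = σ₁ * W (n + 1) + g (n + 1) := by simp only [hg]; ring
      rw [e]
      have hgnorm : ‖g (n + 1)‖ ≤ r ^ (n + 1) * ‖g 0‖ := by
        rw [hgn (n + 1), norm_mul, norm_pow]
        exact mul_le_mul_of_nonneg_right (pow_le_pow_left₀ (norm_nonneg _) (le_max_right _ _) _)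
          (norm_nonneg _)
      calc ‖σ₁ * W (n + 1) + g (n + 1)‖ ≤ ‖σ₁‖ * ‖W (n + 1)‖ + ‖g (n + 1)‖ := by
            rw [← norm_mul]; exact norm_add_le _ _
        _ ≤ r * (r ^ (n + 1) * ‖W 0‖ + (n + 1) * r ^ n * ‖g 0‖) + r ^ (n + 1) * ‖g 0‖ := by
            have h1 : ‖σ₁‖ ≤ r := le_max_left _ _
            have h2 : 0 ≤ ‖W (n + 1)‖ := norm_nonneg _
            nlinarith [norm_nonneg σ₁]
        _ = r ^ (n + 1 + 1) * ‖W 0‖ + ((n + 1 : ℕ) + 1 : ℝ) * r ^ (n + 1) * ‖g 0‖ := by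
            push_cast; ring
  have hlim : Tendsto (fun n : ℕ => r ^ (n + 1) * ‖W 0‖ + ((n : ℝ) + 1) * r ^ n * ‖g 0‖) atTop (𝓝 0) := by
    have h1 : Tendsto (fun n : ℕ => r ^ (n + 1)) atTop (𝓝 0) :=
      (tendsto_pow_atTop_nhds_zero_of_lt_one hr0 hr1).comp (tendsto_add_atTop_nat 1)
    have h2 : Tendsto (fun n : ℕ => (n : ℝ) * r ^ n) atTop (𝓝 0) :=
      tendsto_self_mul_const_pow_of_lt_one hr0 hr1
    have h3 : Tendsto (fun n : ℕ => r ^ n) atTop (𝓝 0) := tendsto_pow_atTop_nhds_zero_of_lt_one hr0 hr1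
    have h := (h1.mul_const ‖W 0‖).add (((h2.add h3)).mul_const ‖g 0‖)
    simp only [zero_mul, zero_add] at h
    refine h.congr fun n => ?_
    ring
  have hW1 : Tendsto (fun n => w (n + 1)) atTop (𝓝 0) := by
    refine squeeze_zero_norm (fun n => ?_) hlim
    have : ‖w (n + 1)‖ = ‖W (n + 1)‖ := by simp only [hW, Complex.norm_real]
    rw [this]
    exact hbound n
  exact (tendsto_add_atTop_iff_nat 1).1 hW1

/-- ★ Uniform Binet for a real cubic `t³ = a t² + b t + c` with a positive dominant root `s`: if `0 < s`, `0 ≤ a`,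
`s³ = as² + bs + c`, `0 < c < s³` and `(a − s)·s² < s³ + c` (so the cofactor `σ² + (1 − a/s)σ + c/s³` is Schur–Cohn
stable: the two other roots have modulus `< s`, real or complex), then every real solution of
`u_{n+3} = a u_{n+2} + b u_{n+1} + c u_n` satisfies `u_n / sⁿ → (s u_2 + s(s − a) u_1 + c u_0) / (s (3s² − 2as − b))`
(the denominator is `s·P′(s)`, `P(t) = t³ − at² − bt − c`). [cite: Stanley2012EC1, §4.1 (Theorem 4.1.1 (iii))] -/
theorem tendsto_div_pow_of_cubic_rec₃ {a b c s : ℝ} (hs : 0 < s) (ha : 0 ≤ a)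
    (hroot : s ^ 3 = a * s ^ 2 + b * s + c) (hc0 : 0 < c) (hc1 : c < s ^ 3) (hsc : (a - s) * s ^ 2 < s ^ 3 + c)
    (u : ℕ → ℝ) (hu : ∀ n, u (n + 3) = a * u (n + 2) + b * u (n + 1) + c * u n) :
    Tendsto (fun n => u n / s ^ n) atTop
      (𝓝 ((s * u 2 + s * (s - a) * u 1 + c * u 0) / (s * (3 * s ^ 2 - 2 * a * s - b)))) := by
  have hs0 : s ≠ 0 := hs.ne'
  set κ : ℝ := c / s ^ 3 with hκ
  set p : ℝ := 1 - a / s with hp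
  have hκ0 : 0 < κ := by rw [hκ]; positivity
  have hκ1 : κ < 1 := by rwa [hκ, div_lt_one (by positivity)]
  have hplo : -(1 + κ) < p := by
    rw [hp, hκ]
    have h1 : (a - s) / s < (s ^ 3 + c) / s ^ 3 := by
      rw [div_lt_div_iff₀ hs (by positivity)]; nlinarith
    have h2 : (a - s) / s = a / s - 1 := by field_simp
    have h3 : (s ^ 3 + c) / s ^ 3 = 1 + c / s ^ 3 := by field_simp
    linarith
  have hphi : p ≤ 1 := by
    rw [hp]; have : 0 ≤ a / s := by positivity
    linarith
  have hpκ : |p| < 1 + κ := by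
    rw [abs_lt]; constructor <;> linarith
  have h1pκ : 0 < 1 + p + κ := by linarith
  -- the normalised recurrence
  set v : ℕ → ℝ := fun n => u n / s ^ n with hv
  have hβ : b / s ^ 2 = p - κ := by
    rw [hp, hκ]
    field_simp
    linear_combination (-1 : ℝ) * hroot
  have hv3 : ∀ n, v (n + 3) = (a / s) * v (n + 2) + (p - κ) * v (n + 1) + κ * v n := by
    intro n
    simp only [hv]
    have hsn : s ^ (n + 3) ≠ 0 := pow_ne_zero _ hs0
    rw [div_eq_iff hsn, hu n, add_mul, add_mul, ← hβ]
    have e1 : a / s * (u (n + 2) / s ^ (n + 2)) * s ^ (n + 3) = a * u (n + 2) := by field_simp; ring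
    have e2 : b / s ^ 2 * (u (n + 1) / s ^ (n + 1)) * s ^ (n + 3) = b * u (n + 1) := by field_simp; ring
    have e3 : κ * (u n / s ^ n) * s ^ (n + 3) = c * u n := by rw [hκ]; field_simp; ring
    rw [e1, e2, e3]
  have hz : ∀ n, v (n + 2) + p * v (n + 1) + κ * v n = v 2 + p * v 1 + κ * v 0 := by
    intro n
    induction n with
    | zero => rfl
    | succ n ih =>
      rw [← ih, show n + 1 + 2 = n + 3 by omega, show n + 1 + 1 = n + 2 by omega, hv3 n, hp]
      ring
  set L : ℝ := (v 2 + p * v 1 + κ * v 0) / (1 + p + κ) with hL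
  have hL' : (1 + p + κ) * L = v 2 + p * v 1 + κ * v 0 := by rw [hL, mul_div_cancel₀ _ h1pκ.ne']
  have hw : ∀ n, (v (n + 2) - L) = -p * (v (n + 1) - L) - κ * (v n - L) := by
    intro n
    linear_combination (hz n) - hL'
  have hlim := tendsto_zero_of_rec_two_schurCohn hκ0 hκ1 hpκ (w := fun n => v n - L) hw
  have hvlim : Tendsto v atTop (𝓝 L) := by
    have := hlim.add_const L
    simpa using this
  -- identify the limit
  have hnum : v 2 + p * v 1 + κ * v 0 = (s * u 2 + s * (s - a) * u 1 + c * u 0) / s ^ 3 := by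
    simp only [hv, hp, hκ, pow_zero, div_one, pow_one]
    field_simp
  have hden : (1 + p + κ) * s ^ 3 = s * (3 * s ^ 2 - 2 * a * s - b) := by
    rw [hp, hκ]
    field_simp
    linear_combination (-1 : ℝ) * hroot
  have hLeq : L = (s * u 2 + s * (s - a) * u 1 + c * u 0) / (s * (3 * s ^ 2 - 2 * a * s - b)) := by
    rw [hL, hnum, ← hden, div_div, mul_comm (s ^ 3) (1 + p + κ)]
  rw [← hLeq]
  exact hvlim


end schurCohn

section quasipoly

/-! ## §C2 The double pole `(1 − yzX⁴)²` -/

/-- A sequence all of whose subsequences along the residue classes modulo `m ≥ 1` tend to `0` tends to `0`.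
[cite: Stanley2012EC1, §4.1 (Theorem 4.1.1 (iii): quasi-polynomial parts)] -/
private theorem tendsto_zero_of_residues {m : ℕ} (hm : 0 < m) {g : ℕ → ℝ}
    (h : ∀ c, Tendsto (fun k => g (m * k + c)) atTop (𝓝 0)) : Tendsto g atTop (𝓝 0) := by
  have hS : Tendsto (fun k => ∑ c ∈ Finset.range m, |g (m * k + c)|) atTop (𝓝 0) := by
    have := tendsto_finsetSum (Finset.range m) fun c _ => (h c).abs
    simpa using this
  have hdiv : Tendsto (fun n : ℕ => n / m) atTop atTop :=
    Filter.tendsto_atTop_atTop.2 fun b => ⟨m * b, fun n hn => (Nat.le_div_iff_mul_le hm).2 (by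
      rw [mul_comm]; exact hn)⟩
  refine squeeze_zero_norm (fun n => ?_) (hS.comp hdiv)
  have hn : g n = g (m * (n / m) + n % m) := by rw [Nat.div_add_mod]
  rw [Real.norm_eq_abs, hn]
  exact Finset.single_le_sum (f := fun c => |g (m * (n / m) + c)|) (fun c _ => abs_nonneg _)
    (Finset.mem_range.2 (Nat.mod_lt n hm))

/-- The coefficients of `V(X)/(1 − wX⁴)²` are negligible against `μ^N` when `0 < w < μ⁴`: every real solution of
`e_{N+8} = 2w e_{N+4} − w² e_N` satisfies `e_N/μ^N → 0` (explicitly `e_{4k+c} = w^k e_c + k w^{k−1}(e_{c+4} − w e_c)`).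
[cite: Stanley2012EC1, §4.1 (Theorem 4.1.1 (iii))] -/
theorem tendsto_div_pow_zero_of_rec_eight_sq {w μ : ℝ} (hw : 0 < w) (hμ : 0 < μ) (hwμ : w < μ ^ 4) {e : ℕ → ℝ}
    (he : ∀ N, e (N + 8) = 2 * w * e (N + 4) - w ^ 2 * e N) :
    Tendsto (fun N => e N / μ ^ N) atTop (𝓝 0) := by
  set f : ℕ → ℝ := fun N => e (N + 4) - w * e N with hf
  have hfrec : ∀ N, f (N + 4) = w * f N := by
    intro N
    simp only [hf]
    rw [show N + 4 + 4 = N + 8 by omega, he N]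
    ring
  have hfk : ∀ c k, f (4 * k + c) = w ^ k * f c := by
    intro c k
    induction k with
    | zero => simp
    | succ k ih => rw [show 4 * (k + 1) + c = 4 * k + c + 4 by ring, hfrec, ih]; ring
  have hek : ∀ c k, e (4 * (k + 1) + c) = w ^ (k + 1) * e c + (k + 1) * w ^ k * f c := by
    intro c k
    induction k with
    | zero =>
      simp only [zero_add, mul_one, pow_one, pow_zero, Nat.cast_zero, hf]
      rw [show 4 * 1 + c = c + 4 by ring]
      ring
    | succ k ih =>
      have e1 : e (4 * (k + 1 + 1) + c) = w * e (4 * (k + 1) + c) + f (4 * (k + 1) + c) := by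
        simp only [hf]
        rw [show 4 * (k + 1 + 1) + c = 4 * (k + 1) + c + 4 by ring]
        ring
      rw [e1, ih, hfk]
      push_cast
      ring
  set ρ : ℝ := w / μ ^ 4 with hρ
  have hρ0 : 0 ≤ ρ := by positivity
  have hρ1 : ρ < 1 := by rwa [hρ, div_lt_one (by positivity)]
  have hμ0 : μ ≠ 0 := hμ.ne'
  refine tendsto_zero_of_residues (by norm_num : 0 < 4) fun c => ?_
  refine (tendsto_add_atTop_iff_nat 1).1 ?_
  have h1 : Tendsto (fun k : ℕ => ρ ^ (k + 1)) atTop (𝓝 0) :=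
    (tendsto_pow_atTop_nhds_zero_of_lt_one hρ0 hρ1).comp (tendsto_add_atTop_nat 1)
  have h2 : Tendsto (fun k : ℕ => (k : ℝ) * ρ ^ k) atTop (𝓝 0) := tendsto_self_mul_const_pow_of_lt_one hρ0 hρ1
  have h3 : Tendsto (fun k : ℕ => ρ ^ k) atTop (𝓝 0) := tendsto_pow_atTop_nhds_zero_of_lt_one hρ0 hρ1
  have h := (h1.mul_const (e c / μ ^ c)).add ((h2.add h3).mul_const (f c / (μ ^ 4 * μ ^ c)))
  simp only [zero_mul, zero_add] at h
  refine h.congr fun k => ?_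
  have hμc : μ ^ (4 * (k + 1) + c) = (μ ^ 4) ^ (k + 1) * μ ^ c := by rw [pow_add, pow_mul]
  rw [hek c k, hρ, hμc, div_pow, div_pow, pow_succ, pow_succ, pow_succ]
  field_simp

end quasipoly

section coefficients

/-! ## §C3 Coefficient recurrences of `U(X)/q(X²)` and `V(X)/(1 − yzX⁴)²`, `q(u) = (1 − yu)(1 − zu) − yzu³` -/

variable {y z : ℝ}

/-- If `φ · q(X²)` is a polynomial `U` then `[X^{N+6}]φ = (y+z)[X^{N+4}]φ − yz[X^{N+2}]φ + yz[X^N]φ + [X^{N+6}]U`.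
[cite: Stanley2012EC1, §4.1 (Theorem 4.1.1 (i) ⟺ (ii))] -/
private theorem coeff_rec_six {φ U : ℝ⟦X⟧}
    (h : φ * ((1 - C y * X ^ 2) * (1 - C z * X ^ 2) - C y * C z * X ^ 6) = U) (N : ℕ) :
    coeff (N + 6) φ = (y + z) * coeff (N + 4) φ - y * z * coeff (N + 2) φ + y * z * coeff N φ + coeff (N + 6) U := by
  have h' : φ = U + C (y + z) * (φ * X ^ 2) - C (y * z) * (φ * X ^ 4) + C (y * z) * (φ * X ^ 6) := by
    simp only [map_add, map_mul]
    linear_combination h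
  have e2 : coeff (N + 6) (φ * X ^ 2) = coeff (N + 4) φ := by
    rw [show N + 6 = N + 4 + 2 by ring, PowerSeries.coeff_mul_X_pow]
  have e4 : coeff (N + 6) (φ * X ^ 4) = coeff (N + 2) φ := by
    rw [show N + 6 = N + 2 + 4 by ring, PowerSeries.coeff_mul_X_pow]
  have e6 : coeff (N + 6) (φ * X ^ 6) = coeff N φ := PowerSeries.coeff_mul_X_pow φ 6 N
  have := congrArg (coeff (N + 6)) h'
  rw [map_add, map_sub, map_add, PowerSeries.coeff_C_mul, PowerSeries.coeff_C_mul, PowerSeries.coeff_C_mul, e2, e4, e6]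
    at this
  linear_combination this

/-- … and the first six coefficients of `φ` in terms of those of `U`. [cite: Stanley2012EC1, §4.1 (Theorem 4.1.1)] -/
private theorem coeff_init_six {φ U : ℝ⟦X⟧}
    (h : φ * ((1 - C y * X ^ 2) * (1 - C z * X ^ 2) - C y * C z * X ^ 6) = U) :
    coeff 0 φ = coeff 0 U ∧ coeff 1 φ = coeff 1 U ∧ coeff 2 φ = coeff 2 U + (y + z) * coeff 0 φ
      ∧ coeff 3 φ = coeff 3 U + (y + z) * coeff 1 φ
      ∧ coeff 4 φ = coeff 4 U + (y + z) * coeff 2 φ - y * z * coeff 0 φ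
      ∧ coeff 5 φ = coeff 5 U + (y + z) * coeff 3 φ - y * z * coeff 1 φ := by
  set p₁ : ℝ := y + z with hp₁
  set p₂ : ℝ := y * z with hp₂
  have h' : φ = U + C p₁ * (φ * X ^ 2) - C p₂ * (φ * X ^ 4) + C p₂ * (φ * X ^ 6) := by
    simp only [hp₁, hp₂, map_add, map_mul]
    linear_combination h
  have h0 := congrArg (coeff 0) h'
  have h1 := congrArg (coeff 1) h'
  have h2 := congrArg (coeff 2) h'
  have h3 := congrArg (coeff 3) h'
  have h4 := congrArg (coeff 4) h'
  have h5 := congrArg (coeff 5) h'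
  simp only [map_add, map_sub, PowerSeries.coeff_C_mul, PowerSeries.coeff_mul_X_pow'] at h0 h1 h2 h3 h4 h5
  norm_num at h0 h1 h2 h3 h4 h5
  rw [← PowerSeries.coeff_zero_eq_constantCoeff_apply, ← PowerSeries.coeff_zero_eq_constantCoeff_apply] at h0
  rw [← PowerSeries.coeff_zero_eq_constantCoeff_apply] at h2 h4
  exact ⟨h0, h1, by linear_combination h2, by linear_combination h3, by linear_combination h4,
    by linear_combination h5⟩

/-- If `φ · (1 − yzX⁴)²` is a polynomial `V` then `[X^{N+8}]φ = 2yz[X^{N+4}]φ − y²z²[X^N]φ + [X^{N+8}]V`.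
[cite: Stanley2012EC1, §4.1 (Theorem 4.1.1 (i) ⟺ (ii))] -/
private theorem coeff_rec_eight_yz {φ V : ℝ⟦X⟧} (h : φ * (1 - C y * C z * X ^ 4) ^ 2 = V) (N : ℕ) :
    coeff (N + 8) φ = 2 * (y * z) * coeff (N + 4) φ - (y * z) ^ 2 * coeff N φ + coeff (N + 8) V := by
  have h' : φ = V + C (2 * (y * z)) * (φ * X ^ 4) - C ((y * z) ^ 2) * (φ * X ^ 8) := by
    simp only [map_mul, map_pow, map_ofNat]
    linear_combination h
  have e4 : coeff (N + 8) (φ * X ^ 4) = coeff (N + 4) φ := by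
    rw [show N + 8 = N + 4 + 4 by ring, PowerSeries.coeff_mul_X_pow]
  have e8 : coeff (N + 8) (φ * X ^ 8) = coeff N φ := PowerSeries.coeff_mul_X_pow φ 8 N
  have := congrArg (coeff (N + 8)) h'
  rw [map_sub, map_add, PowerSeries.coeff_C_mul, PowerSeries.coeff_C_mul, e4, e8] at this
  linear_combination this

end coefficients

section core

/-! ## §C4 The core: from a partial-fraction decomposition to the parity-resolved limits -/

variable {y z : ℝ}

/-- `μ_1(y,z)^n ≤ K(y)K(z)·C_{1,n}(y,z)` (Fekete: `μ_1 = inf`), so `C_{1,n}/μ_1^n` is bounded below by a positive constant.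
[cite: BeatonBousquetMelouDeGierDuminilCopinGuttmann2014, §3.2 Proposition 6 (arXiv v5 p. 10: μ_T(y,z))] -/
theorem stripMuY₂_one_pow_le (hy : 0 < y) (hz : 0 < z) {n : ℕ} (hn : n ≠ 0) :
    stripMuY₂ 1 y z ^ n ≤ yK y * yK z * stripZ₂ 1 n y z := by
  have hμ := stripMuY₂_pos 1 hy hz
  have hK : 0 ≤ yK y * yK z * stripZ₂ 1 n y z :=
    mul_nonneg (mul_nonneg (by linarith [one_le_yK y]) (by linarith [one_le_yK z])) (stripZ₂_pos 1 n hy hz).le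
  have h := stripMuY₂_le_rpow 1 hy hz hn
  have hn' : (0 : ℝ) < n := by exact_mod_cast Nat.pos_of_ne_zero hn
  calc stripMuY₂ 1 y z ^ n ≤ ((yK y * yK z * stripZ₂ 1 n y z) ^ (1 / (n : ℝ))) ^ n :=
        pow_le_pow_left₀ hμ.le h n
    _ = yK y * yK z * stripZ₂ 1 n y z := by
        rw [← Real.rpow_natCast, ← Real.rpow_mul hK, one_div_mul_cancel hn'.ne', Real.rpow_one]

/-- THE CORE LEMMA.  Given a partial-fraction decomposition `d·P(X;y,z) = E·q(X²)(1−yzX⁴)² + U·(1−yzX⁴)² + V·q(X²)` of the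
numerator of the landed series `stripZ₂_one_series` with `deg E ≤ 1`, `deg U ≤ 5`, `deg V ≤ 7`, `d ≠ 0`, the parity
subsequences converge: for every `c`,
`C_{1,2M+c}(y,z) / μ_1(y,z)^{2M+c} → [s·u_{c+4} + s(s − y − z)·u_{c+2} + yz·u_c] / (d · μ^c · s·(3s² − 2(y+z)s + yz))`,
`s = μ_1(y,z)²`, where `u_k = [X^k] U(X)/q(X²)`. [cite: Stanley2012EC1, §4.1 (Theorem 4.1.1 (iii)); BeatonBousquetMelouDeGierDuminilCopinGuttmann2014, §3.2 (arXiv v5 p. 12: the strip series are rational)] -/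
theorem tendsto_stripZ₂_one_parity_of_decomposition (hy : 0 < y) (hz : 0 < z) {E U V : ℝ⟦X⟧} {d : ℝ} (hd : d ≠ 0)
    (hPF : C d * twoWallP y z = E * (((1 - C y * X ^ 2) * (1 - C z * X ^ 2) - C y * C z * X ^ 6)
      * (1 - C y * C z * X ^ 4) ^ 2) + U * (1 - C y * C z * X ^ 4) ^ 2
      + V * ((1 - C y * X ^ 2) * (1 - C z * X ^ 2) - C y * C z * X ^ 6))
    (hE : ∀ N, coeff (N + 2) E = 0) (hU : ∀ N, coeff (N + 6) U = 0) (hV : ∀ N, coeff (N + 8) V = 0) (c : ℕ) :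
    Tendsto (fun M => stripZ₂ 1 (2 * M + c) y z / stripMuY₂ 1 y z ^ (2 * M + c)) atTop
      (𝓝 ((stripMuY₂ 1 y z ^ 2
            * coeff (c + 4) (U * PowerSeries.invOfUnit ((1 - C y * X ^ 2) * (1 - C z * X ^ 2) - C y * C z * X ^ 6) 1)
          + stripMuY₂ 1 y z ^ 2 * (stripMuY₂ 1 y z ^ 2 - (y + z))
            * coeff (c + 2) (U * PowerSeries.invOfUnit ((1 - C y * X ^ 2) * (1 - C z * X ^ 2) - C y * C z * X ^ 6) 1)
          + y * z * coeff c (U * PowerSeries.invOfUnit ((1 - C y * X ^ 2) * (1 - C z * X ^ 2) - C y * C z * X ^ 6) 1))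
        / (d * stripMuY₂ 1 y z ^ c
          * (stripMuY₂ 1 y z ^ 2 * (3 * (stripMuY₂ 1 y z ^ 2) ^ 2 - 2 * (y + z) * stripMuY₂ 1 y z ^ 2 - -(y * z)))))) := by
  set μ := stripMuY₂ 1 y z with hμdef
  have hμ : 0 < μ := stripMuY₂_pos 1 hy hz
  have hμ0 : μ ≠ 0 := hμ.ne'
  set s := μ ^ 2 with hsdef
  have hs : 0 < s := by positivity
  have hsex : s * (s - y) * (s - z) = y * z := stripMuY₂_one_sq_poly_eq hy hz
  have hmax : max y z < s := max_lt_stripMuY₂_one_sq hy hz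
  have hys : y < s := lt_of_le_of_lt (le_max_left _ _) hmax
  have hzs : z < s := lt_of_le_of_lt (le_max_right _ _) hmax
  -- power series
  set A : ℝ⟦X⟧ := PowerSeries.mk (fun N => stripZ₂ 1 N y z) with hA
  set qX : ℝ⟦X⟧ := (1 - C y * X ^ 2) * (1 - C z * X ^ 2) - C y * C z * X ^ 6 with hqX
  set Q2 : ℝ⟦X⟧ := (1 - C y * C z * X ^ 4) ^ 2 with hQ2
  have hS : A * (qX * Q2) = twoWallP y z := stripZ₂_one_series y z
  set iq : ℝ⟦X⟧ := PowerSeries.invOfUnit qX 1 with hiq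
  set iQ : ℝ⟦X⟧ := PowerSeries.invOfUnit Q2 1 with hiQ
  have hqinv : qX * iq = 1 := PowerSeries.mul_invOfUnit qX 1 (by simp [hqX])
  have hQinv : Q2 * iQ = 1 := PowerSeries.mul_invOfUnit Q2 1 (by simp [hQ2])
  have hdec : C d * A = E + U * iq + V * iQ := by
    linear_combination (-(C d) * A * Q2 * iQ + E * Q2 * iQ + V * iQ) * hqinv + (-(C d) * A + E + U * iq) * hQinv
      + (C d * iq * iQ) * hS + (iq * iQ) * hPF
  -- coefficient sequences
  set u : ℕ → ℝ := fun N => coeff N (U * iq) with hu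
  set e : ℕ → ℝ := fun N => coeff N (V * iQ) with he
  have hUiq : U * iq * ((1 - C y * X ^ 2) * (1 - C z * X ^ 2) - C y * C z * X ^ 6) = U := by
    rw [← hqX, mul_assoc, mul_comm iq qX, hqinv, mul_one]
  have hurec : ∀ N, u (N + 6) = (y + z) * u (N + 4) - y * z * u (N + 2) + y * z * u N := by
    intro N; have := coeff_rec_six hUiq N; rw [hU N, add_zero] at this; exact this
  have hViQ : V * iQ * (1 - C y * C z * X ^ 4) ^ 2 = V := by
    rw [← hQ2, mul_assoc, mul_comm iQ Q2, hQinv, mul_one]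
  have herec : ∀ N, e (N + 8) = 2 * (y * z) * e (N + 4) - (y * z) ^ 2 * e N := by
    intro N; have := coeff_rec_eight_yz hViQ N; rw [hV N, add_zero] at this; exact this
  -- coefficient extraction: `d · C_{1,N+2} = u_{N+2} + e_{N+2}`
  have hcoef : ∀ N, d * stripZ₂ 1 (N + 2) y z = u (N + 2) + e (N + 2) := by
    intro N
    have := congrArg (coeff (N + 2)) hdec
    simp only [hA, map_add, PowerSeries.coeff_C_mul, coeff_mk, hE N, zero_add] at this
    simpa only [hu, he] using this
  -- the parity subsequence of `u`
  set b : ℕ → ℝ := fun M => u (2 * M + c) with hb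
  have hbrec : ∀ M, b (M + 3) = (y + z) * b (M + 2) + -(y * z) * b (M + 1) + y * z * b M := by
    intro M
    simp only [hb]
    rw [show 2 * (M + 3) + c = 2 * M + c + 6 by ring, show 2 * (M + 2) + c = 2 * M + c + 4 by ring,
      show 2 * (M + 1) + c = 2 * M + c + 2 by ring, hurec]
    ring
  have hroot : s ^ 3 = (y + z) * s ^ 2 + -(y * z) * s + y * z := by linear_combination hsex
  have hyz : 0 < y * z := mul_pos hy hz
  have hc1 : y * z < s ^ 3 := by nlinarith [mul_pos hs hyz, mul_pos (mul_pos hs hs) hy]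
  have hsc : (y + z - s) * s ^ 2 < s ^ 3 + y * z := by
    nlinarith [mul_pos hy (mul_pos (sub_pos.2 hzs) (sub_pos.2 hzs)), mul_pos hz (sub_pos.2 (show y * z < s ^ 2 by nlinarith))]
  have hblim := tendsto_div_pow_of_cubic_rec₃ hs (by linarith) hroot hyz hc1 hsc b hbrec
  -- `e` is negligible
  have hyzs : y * z < μ ^ 4 := by
    have : μ ^ 4 = s ^ 2 := by rw [hsdef]; ring
    rw [this]; nlinarith
  have helim := tendsto_div_pow_zero_of_rec_eight_sq hyz hμ hyzs herec
  have helim' : Tendsto (fun M => e (2 * M + c) / μ ^ (2 * M + c) * μ ^ c) atTop (𝓝 0) := by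
    have h := (helim.comp (tendsto_atTop_atTop.2 fun B => ⟨B, fun M hM => by omega⟩ :
      Tendsto (fun M => 2 * M + c) atTop atTop)).mul_const (μ ^ c)
    rw [zero_mul] at h
    exact h
  -- assemble along `N = 2(M+1) + c`
  have hlim := ((hblim.comp (tendsto_add_atTop_nat 1)).add
    (helim'.comp (tendsto_add_atTop_nat 1))).div_const (d * μ ^ c)
  rw [add_zero] at hlim
  have key : Tendsto (fun M => stripZ₂ 1 (2 * (M + 1) + c) y z / μ ^ (2 * (M + 1) + c)) atTop
      (𝓝 ((s * b 2 + s * (s - (y + z)) * b 1 + y * z * b 0) / (s * (3 * s ^ 2 - 2 * (y + z) * s - -(y * z)))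
        / (d * μ ^ c))) := by
    refine hlim.congr fun M => ?_
    simp only [Function.comp_apply, hb]
    have hN : 2 * (M + 1) + c = 2 * M + c + 2 := by ring
    have hZ : stripZ₂ 1 (2 * M + c + 2) y z = (u (2 * M + c + 2) + e (2 * M + c + 2)) / d := by
      rw [eq_div_iff hd, mul_comm]; exact hcoef _
    have hμpow : μ ^ (2 * M + c + 2) = s ^ (M + 1) * μ ^ c := by
      rw [hsdef, ← pow_mul, ← pow_add]; ring_nf
    rw [hN, hZ, hμpow]
    field_simp
  have key' := (tendsto_add_atTop_iff_nat (f := fun M => stripZ₂ 1 (2 * M + c) y z / μ ^ (2 * M + c)) 1).1 key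
  convert key' using 2
  simp only [hb, hu]
  rw [show 2 * 2 + c = c + 4 by ring, show 2 * 1 + c = c + 2 by ring, show 2 * 0 + c = c by ring, div_div,
    mul_comm (d * μ ^ c)]

end core

section amplitudes

/-! ## §C5 The explicit parity-resolved amplitudes -/

variable {y z : ℝ}

set_option maxHeartbeats 400000 in
/-- ★★★ **Even-length amplitude of the two-fugacity one-cell strip**: for all `y, z > 0`,
`C_{1,2M}(y,z) / μ_1(y,z)^{2M} → A₀(y,z) = s·(U₀ s² + U₂ s + U₄) / (((y−z)² + 2y + 2z + 1)²·((y+z)s² − 2yz·s + 3yz))`,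
`s = μ_1(y,z)²` (the root of the sextic law `s(s−y)(s−z) = yz`), with the bivariate integer polynomials `U₀, U₂, U₄` of the
partial-fraction numerator `U = Σ U_j X^j` printed in the statement (found by `kit/pf3.py`, verified here by `ring`).
[cite: BeatonBousquetMelouDeGierDuminilCopinGuttmann2014, §3.2 (arXiv v5 p. 10: C_{T,N}(y,z), Proposition 6: μ_T(y,z); p. 12: the strip series are rational); MadrasSlade1993, §1.1 eq. (1.1.4) p. 5 (the amplitude A), §8.5 Notes pp. 278–279 (γ(R) = 1); AlmJanson1990; Stanley2012EC1, §4.1 (Theorem 4.1.1 (iii))] -/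
theorem tendsto_stripZ₂_one_even_div_pow (hy : 0 < y) (hz : 0 < z) :
    Tendsto (fun M => stripZ₂ 1 (2 * M) y z / stripMuY₂ 1 y z ^ (2 * M)) atTop
      (𝓝 (stripMuY₂ 1 y z ^ 2 * ((4 + 46 * z + 58 * z ^ 2 + 28 * z ^ 3 + 14 * z ^ 4 + 2 * z ^ 5 + 46 * y + 80 * y * z + 44 * y * z ^ 2 - 4 * y * z ^ 3 - 6 * y * z ^ 4 + 58 * y ^ 2 + 44 * y ^ 2 * z - 20 * y ^ 2 * z ^ 2 + 4 * y ^ 2 * z ^ 3 + 28 * y ^ 3 - 4 * y ^ 3 * z + 4 * y ^ 3 * z ^ 2 + 14 * y ^ 4 - 6 * y ^ 4 * z + 2 * y ^ 5) * (stripMuY₂ 1 y z ^ 2) ^ 2 + (10 * z - 4 * z ^ 2 - 6 * z ^ 3 + 8 * z ^ 4 + 10 * y - 12 * y * z + 4 * y * z ^ 2 - 36 * y * z ^ 3 - 26 * y * z ^ 4 - 4 * y * z ^ 5 - 4 * y ^ 2 + 4 * y ^ 2 * z - 88 * y ^ 2 * z ^ 2 + 26 * y ^ 2 * z ^ 3 +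 16 * y ^ 2 * z ^ 4 - 6 * y ^ 3 - 36 * y ^ 3 * z + 26 * y ^ 3 * z ^ 2 - 24 * y ^ 3 * z ^ 3 + 8 * y ^ 4 - 26 * y ^ 4 * z + 16 * y ^ 4 * z ^ 2 - 4 * y ^ 5 * z) * stripMuY₂ 1 y z ^ 2 + (2 * z - 4 * z ^ 3 + 2 * z ^ 5 + 2 * y + 8 * y * z + 78 * y * z ^ 2 + 56 * y * z ^ 3 + 20 * y * z ^ 4 + 4 * y * z ^ 5 + 78 * y ^ 2 * z + 32 * y ^ 2 * z ^ 2 - 22 * y ^ 2 * z ^ 3 - 16 * y ^ 2 * z ^ 4 - 4 * y ^ 3 + 56 * y ^ 3 * z - 22 * y ^ 3 * z ^ 2 + 24 * y ^ 3 * z ^ 3 + 20 * y ^ 4 * z - 16 * y ^ 4 * z ^ 2 + 2 * y ^ 5 + 4 * y ^ 5 * z))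
        / (((y - z) ^ 2 + 2 * y + 2 * z + 1) ^ 2 * ((y + z) * (stripMuY₂ 1 y z ^ 2) ^ 2 - 2 * (y * z) * stripMuY₂ 1 y z ^ 2 + 3 * (y * z))))) := by
  set μ := stripMuY₂ 1 y z with hμdef
  have hμ : 0 < μ := stripMuY₂_pos 1 hy hz
  have hμ0 : μ ≠ 0 := hμ.ne'
  set s := μ ^ 2 with hsdef
  have hs : 0 < s := by positivity
  have hsex : s * (s - y) * (s - z) = y * z := stripMuY₂_one_sq_poly_eq hy hz
  have hsex' : s ^ 3 = (y + z) * s ^ 2 - y * z * s + y * z := by linear_combination hsex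
  have hd0 : (((y - z) ^ 2 + 2 * y + 2 * z + 1) ^ 2 : ℝ) ≠ 0 := by positivity
  -- the sixteen coefficient polynomials of the partial-fraction decomposition (kit/pf3.py)
  obtain ⟨e0, he0⟩ : ∃ r : ℝ, r = 2 + 7 * z + 8 * z ^ 2 + 2 * z ^ 3 - 2 * z ^ 4 - z ^ 5 + 7 * y - 18 * y * z ^ 2 - 8 * y * z ^ 3 + 3 * y * z ^ 4 + 8 * y ^ 2 - 18 * y ^ 2 * z + 20 * y ^ 2 * z ^ 2 - 2 * y ^ 2 * z ^ 3 + 2 * y ^ 3 - 8 * y ^ 3 * z - 2 * y ^ 3 * z ^ 2 - 2 * y ^ 4 + 3 * y ^ 4 * z - y ^ 5 := ⟨_, rfl⟩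
  obtain ⟨e1, he1⟩ : ∃ r : ℝ, r = -2 - 8 * z - 12 * z ^ 2 - 8 * z ^ 3 - 2 * z ^ 4 - 8 * y - 8 * y * z + 8 * y * z ^ 2 + 8 * y * z ^ 3 - 12 * y ^ 2 + 8 * y ^ 2 * z - 12 * y ^ 2 * z ^ 2 - 8 * y ^ 3 + 8 * y ^ 3 * z - 2 * y ^ 4 := ⟨_, rfl⟩
  obtain ⟨u0, hu0⟩ : ∃ r : ℝ, r = 4 + 46 * z + 58 * z ^ 2 + 28 * z ^ 3 + 14 * z ^ 4 + 2 * z ^ 5 + 46 * y + 80 * y * z + 44 * y * z ^ 2 - 4 * y * z ^ 3 - 6 * y * z ^ 4 + 58 * y ^ 2 + 44 * y ^ 2 * z - 20 * y ^ 2 * z ^ 2 + 4 * y ^ 2 * z ^ 3 + 28 * y ^ 3 - 4 * y ^ 3 * z + 4 * y ^ 3 * z ^ 2 + 14 * y ^ 4 - 6 * y ^ 4 * z + 2 * y ^ 5 := ⟨_, rfl⟩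
  obtain ⟨u1, hu1⟩ : ∃ r : ℝ, r = 4 + 16 * z + 36 * z ^ 2 + 44 * z ^ 3 + 24 * z ^ 4 + 4 * z ^ 5 + 16 * y + 148 * y * z + 124 * y * z ^ 2 + 12 * y * z ^ 3 - 12 * y * z ^ 4 + 36 * y ^ 2 + 124 * y ^ 2 * z - 72 * y ^ 2 * z ^ 2 + 8 * y ^ 2 * z ^ 3 + 44 * y ^ 3 + 12 * y ^ 3 * z + 8 * y ^ 3 * z ^ 2 + 24 * y ^ 4 - 12 * y ^ 4 * z + 4 * y ^ 5 := ⟨_, rfl⟩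
  obtain ⟨u2, hu2⟩ : ∃ r : ℝ, r = 10 * z - 4 * z ^ 2 - 6 * z ^ 3 + 8 * z ^ 4 + 10 * y - 12 * y * z + 4 * y * z ^ 2 - 36 * y * z ^ 3 - 26 * y * z ^ 4 - 4 * y * z ^ 5 - 4 * y ^ 2 + 4 * y ^ 2 * z - 88 * y ^ 2 * z ^ 2 + 26 * y ^ 2 * z ^ 3 + 16 * y ^ 2 * z ^ 4 - 6 * y ^ 3 - 36 * y ^ 3 * z + 26 * y ^ 3 * z ^ 2 - 24 * y ^ 3 * z ^ 3 + 8 * y ^ 4 - 26 * y ^ 4 * z + 16 * y ^ 4 * z ^ 2 - 4 * y ^ 5 * z := ⟨_, rfl⟩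
  obtain ⟨u3, hu3⟩ : ∃ r : ℝ, r = 4 * z ^ 2 + 4 * z ^ 3 - 4 * z ^ 4 - 4 * z ^ 5 + 52 * y * z - 16 * y * z ^ 2 - 44 * y * z ^ 3 - 8 * y * z ^ 4 + 4 * y ^ 2 - 16 * y ^ 2 * z - 96 * y ^ 2 * z ^ 2 + 12 * y ^ 2 * z ^ 3 + 4 * y ^ 3 - 44 * y ^ 3 * z + 12 * y ^ 3 * z ^ 2 - 4 * y ^ 4 - 8 * y ^ 4 * z - 4 * y ^ 5 := ⟨_, rfl⟩
  obtain ⟨u4, hu4⟩ : ∃ r : ℝ, r = 2 * z - 4 * z ^ 3 + 2 * z ^ 5 + 2 * y + 8 * y * z + 78 * y * z ^ 2 + 56 * y * z ^ 3 + 20 * y * z ^ 4 + 4 * y * z ^ 5 + 78 * y ^ 2 * z + 32 * y ^ 2 * z ^ 2 - 22 * y ^ 2 * z ^ 3 - 16 * y ^ 2 * z ^ 4 - 4 * y ^ 3 + 56 * y ^ 3 * z - 22 * y ^ 3 * z ^ 2 + 24 * y ^ 3 * z ^ 3 + 20 * y ^ 4 * z - 16 * y ^ 4 * z ^ 2 +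 2 * y ^ 5 + 4 * y ^ 5 * z := ⟨_, rfl⟩
  obtain ⟨u5, hu5⟩ : ∃ r : ℝ, r = 24 * y * z + 36 * y * z ^ 2 + 32 * y * z ^ 3 + 20 * y * z ^ 4 + 36 * y ^ 2 * z + 128 * y ^ 2 * z ^ 2 - 20 * y ^ 2 * z ^ 3 + 32 * y ^ 3 * z - 20 * y ^ 3 * z ^ 2 + 20 * y ^ 4 * z := ⟨_, rfl⟩
  obtain ⟨v0, hv0⟩ : ∃ r : ℝ, r = -4 - 44 * z - 50 * z ^ 2 - 16 * z ^ 3 - 6 * z ^ 4 - 44 * y - 64 * y * z - 24 * y * z ^ 2 + 4 * y * z ^ 3 - 50 * y ^ 2 - 24 * y ^ 2 * z + 4 * y ^ 2 * z ^ 2 - 16 * y ^ 3 + 4 * y ^ 3 * z - 6 * y ^ 4 := ⟨_, rfl⟩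
  obtain ⟨v1, hv1⟩ : ∃ r : ℝ, r = 4 * z + 4 * z ^ 2 - 4 * z ^ 3 - 4 * z ^ 4 + 4 * y - 100 * y * z - 100 * y * z ^ 2 - 28 * y * z ^ 3 + 4 * y ^ 2 - 100 * y ^ 2 * z + 64 * y ^ 2 * z ^ 2 - 4 * y ^ 3 - 28 * y ^ 3 * z - 4 * y ^ 4 := ⟨_, rfl⟩
  obtain ⟨v2, hv2⟩ : ∃ r : ℝ, r = -8 * z - 16 * z ^ 2 - 8 * z ^ 3 - 8 * y - 32 * y * z - 74 * y * z ^ 2 - 28 * y * z ^ 3 - 10 * y * z ^ 4 - 16 * y ^ 2 - 74 * y ^ 2 * z - 24 * y ^ 2 * z ^ 2 + 10 * y ^ 2 * z ^ 3 - 8 * y ^ 3 - 28 * y ^ 3 * z + 10 * y ^ 3 * z ^ 2 - 10 * y ^ 4 * z := ⟨_, rfl⟩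
  obtain ⟨v3, hv3⟩ : ∃ r : ℝ, r = -44 * y * z - 80 * y * z ^ 2 - 60 * y * z ^ 3 - 24 * y * z ^ 4 - 80 * y ^ 2 * z - 104 * y ^ 2 * z ^ 2 + 24 * y ^ 2 * z ^ 3 - 60 * y ^ 3 * z + 24 * y ^ 3 * z ^ 2 - 24 * y ^ 4 * z := ⟨_, rfl⟩
  obtain ⟨v4, hv4⟩ : ∃ r : ℝ, r = 8 * y * z + 42 * y * z ^ 2 + 36 * y * z ^ 3 + 10 * y * z ^ 4 + 8 * y * z ^ 5 + 42 * y ^ 2 * z + 12 * y ^ 2 * z ^ 2 + 30 * y ^ 2 * z ^ 3 - 12 * y ^ 2 * z ^ 4 + 36 * y ^ 3 * z + 30 * y ^ 3 * z ^ 2 + 8 * y ^ 3 * z ^ 3 + 10 * y ^ 4 * z - 12 * y ^ 4 * z ^ 2 + 8 * y ^ 5 * z := ⟨_, rfl⟩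
  obtain ⟨v5, hv5⟩ : ∃ r : ℝ, r = -4 * y * z - 12 * y * z ^ 2 - 4 * y * z ^ 3 + 12 * y * z ^ 4 + 8 * y * z ^ 5 - 12 * y ^ 2 * z + 92 * y ^ 2 * z ^ 2 + 76 * y ^ 2 * z ^ 3 + 4 * y ^ 2 * z ^ 4 - 4 * y ^ 3 * z + 76 * y ^ 3 * z ^ 2 - 24 * y ^ 3 * z ^ 3 + 12 * y ^ 4 * z + 4 * y ^ 4 * z ^ 2 + 8 * y ^ 5 * z := ⟨_, rfl⟩
  obtain ⟨v6, hv6⟩ : ∃ r : ℝ, r = -8 * y * z ^ 3 - 16 * y * z ^ 4 - 8 * y * z ^ 5 - 12 * y ^ 2 * z ^ 2 + 42 * y ^ 2 * z ^ 3 + 32 * y ^ 2 * z ^ 4 + 10 * y ^ 2 * z ^ 5 - 8 * y ^ 3 * z + 42 * y ^ 3 * z ^ 2 + 32 * y ^ 3 * z ^ 3 - 10 * y ^ 3 * z ^ 4 - 16 * y ^ 4 * z + 32 * y ^ 4 * z ^ 2 - 10 * y ^ 4 * z ^ 3 - 8 * y ^ 5 * z + 10 * y ^ 5 * z ^ 2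 := ⟨_, rfl⟩
  obtain ⟨v7, hv7⟩ : ∃ r : ℝ, r = 24 * y ^ 2 * z ^ 2 + 36 * y ^ 2 * z ^ 3 + 32 * y ^ 2 * z ^ 4 + 20 * y ^ 2 * z ^ 5 + 36 * y ^ 3 * z ^ 2 + 128 * y ^ 3 * z ^ 3 - 20 * y ^ 3 * z ^ 4 + 32 * y ^ 4 * z ^ 2 - 20 * y ^ 4 * z ^ 3 + 20 * y ^ 5 * z ^ 2 := ⟨_, rfl⟩
  have hPF : C (((y - z) ^ 2 + 2 * y + 2 * z + 1) ^ 2) * twoWallP y z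
      = (C e0 + C e1 * X) * (((1 - C y * X ^ 2) * (1 - C z * X ^ 2) - C y * C z * X ^ 6) * (1 - C y * C z * X ^ 4) ^ 2)
      + (C u0 + C u1 * X + C u2 * X ^ 2 + C u3 * X ^ 3 + C u4 * X ^ 4 + C u5 * X ^ 5) * (1 - C y * C z * X ^ 4) ^ 2
      + (C v0 + C v1 * X + C v2 * X ^ 2 + C v3 * X ^ 3 + C v4 * X ^ 4 + C v5 * X ^ 5 + C v6 * X ^ 6 + C v7 * X ^ 7) * ((1 - C y * X ^ 2) * (1 - C z * X ^ 2) - C y * C z * X ^ 6) := by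
    rw [he0, he1, hu0, hu1, hu2, hu3, hu4, hu5, hv0, hv1, hv2, hv3, hv4, hv5, hv6, hv7]
    simp only [twoWallP, map_add, map_sub, map_mul, map_pow, map_neg, map_ofNat, map_one]
    ring
  have hEc : ∀ N, coeff (N + 2) (C e0 + C e1 * X) = 0 := by
    intro N
    simp only [map_add, PowerSeries.coeff_C_mul, PowerSeries.coeff_C, coeff_X, Nat.reduceEqDiff, if_false,
      mul_zero, add_zero]
  have hUc : ∀ N, coeff (N + 6) (C u0 + C u1 * X + C u2 * X ^ 2 + C u3 * X ^ 3 + C u4 * X ^ 4 + C u5 * X ^ 5) = 0 := by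
    intro N
    simp only [map_add, PowerSeries.coeff_C_mul, PowerSeries.coeff_C, coeff_X, PowerSeries.coeff_X_pow,
      Nat.reduceEqDiff, if_false, mul_zero, add_zero]
  have hVc : ∀ N, coeff (N + 8) (C v0 + C v1 * X + C v2 * X ^ 2 + C v3 * X ^ 3 + C v4 * X ^ 4 + C v5 * X ^ 5 + C v6 * X ^ 6 + C v7 * X ^ 7) = 0 := by
    intro N
    simp only [map_add, PowerSeries.coeff_C_mul, PowerSeries.coeff_C, coeff_X, PowerSeries.coeff_X_pow,
      Nat.reduceEqDiff, if_false, mul_zero, add_zero]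
  -- the initial coefficients of `U/q(X²)`
  obtain ⟨iq, hiq⟩ : ∃ iq : ℝ⟦X⟧, iq = PowerSeries.invOfUnit ((1 - C y * X ^ 2) * (1 - C z * X ^ 2) - C y * C z * X ^ 6) 1 := ⟨_, rfl⟩
  have hqinv : ((1 - C y * X ^ 2) * (1 - C z * X ^ 2) - C y * C z * X ^ 6) * iq = 1 := by
    rw [hiq]; exact PowerSeries.mul_invOfUnit _ 1 (by simp)
  have hUiq : (C u0 + C u1 * X + C u2 * X ^ 2 + C u3 * X ^ 3 + C u4 * X ^ 4 + C u5 * X ^ 5) * iq * ((1 - C y * X ^ 2) * (1 - C z * X ^ 2) - C y * C z * X ^ 6)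
      = (C u0 + C u1 * X + C u2 * X ^ 2 + C u3 * X ^ 3 + C u4 * X ^ 4 + C u5 * X ^ 5) := by
    rw [mul_assoc, mul_comm iq, hqinv, mul_one]
  obtain ⟨h0, h1, h2, h3, h4, h5⟩ := coeff_init_six hUiq
  have cU0 : coeff 0 (C u0 + C u1 * X + C u2 * X ^ 2 + C u3 * X ^ 3 + C u4 * X ^ 4 + C u5 * X ^ 5) = u0 := by
    simp only [map_add, PowerSeries.coeff_C_mul, PowerSeries.coeff_C, coeff_X, PowerSeries.coeff_X_pow]; norm_num
  have cU1 : coeff 1 (C u0 + C u1 * X + C u2 * X ^ 2 + C u3 * X ^ 3 + C u4 * X ^ 4 + C u5 * X ^ 5) = u1 := by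
    simp only [map_add, PowerSeries.coeff_C_mul, PowerSeries.coeff_C, coeff_X, PowerSeries.coeff_X_pow]; norm_num
  have cU2 : coeff 2 (C u0 + C u1 * X + C u2 * X ^ 2 + C u3 * X ^ 3 + C u4 * X ^ 4 + C u5 * X ^ 5) = u2 := by
    simp only [map_add, PowerSeries.coeff_C_mul, PowerSeries.coeff_C, coeff_X, PowerSeries.coeff_X_pow]; norm_num
  have cU3 : coeff 3 (C u0 + C u1 * X + C u2 * X ^ 2 + C u3 * X ^ 3 + C u4 * X ^ 4 + C u5 * X ^ 5) = u3 := by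
    simp only [map_add, PowerSeries.coeff_C_mul, PowerSeries.coeff_C, coeff_X, PowerSeries.coeff_X_pow]; norm_num
  have cU4 : coeff 4 (C u0 + C u1 * X + C u2 * X ^ 2 + C u3 * X ^ 3 + C u4 * X ^ 4 + C u5 * X ^ 5) = u4 := by
    simp only [map_add, PowerSeries.coeff_C_mul, PowerSeries.coeff_C, coeff_X, PowerSeries.coeff_X_pow]; norm_num
  have cU5 : coeff 5 (C u0 + C u1 * X + C u2 * X ^ 2 + C u3 * X ^ 3 + C u4 * X ^ 4 + C u5 * X ^ 5) = u5 := by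
    simp only [map_add, PowerSeries.coeff_C_mul, PowerSeries.coeff_C, coeff_X, PowerSeries.coeff_X_pow]; norm_num
  have g0 : coeff 0 ((C u0 + C u1 * X + C u2 * X ^ 2 + C u3 * X ^ 3 + C u4 * X ^ 4 + C u5 * X ^ 5) * iq) = u0 := by rw [h0, cU0]
  have g1 : coeff 1 ((C u0 + C u1 * X + C u2 * X ^ 2 + C u3 * X ^ 3 + C u4 * X ^ 4 + C u5 * X ^ 5) * iq) = u1 := by rw [h1, cU1]
  have g2 : coeff 2 ((C u0 + C u1 * X + C u2 * X ^ 2 + C u3 * X ^ 3 + C u4 * X ^ 4 + C u5 * X ^ 5) * iq) = u2 + (y + z) * u0 := by rw [h2, cU2, g0]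
  have g3 : coeff 3 ((C u0 + C u1 * X + C u2 * X ^ 2 + C u3 * X ^ 3 + C u4 * X ^ 4 + C u5 * X ^ 5) * iq) = u3 + (y + z) * u1 := by rw [h3, cU3, g1]
  have g4 : coeff 4 ((C u0 + C u1 * X + C u2 * X ^ 2 + C u3 * X ^ 3 + C u4 * X ^ 4 + C u5 * X ^ 5) * iq) = u4 + (y + z) * (u2 + (y + z) * u0) - y * z * u0 := by rw [h4, cU4, g2, g0]
  have g5 : coeff 5 ((C u0 + C u1 * X + C u2 * X ^ 2 + C u3 * X ^ 3 + C u4 * X ^ 4 + C u5 * X ^ 5) * iq) = u5 + (y + z) * (u3 + (y + z) * u1) - y * z * u1 := by rw [h5, cU5, g3, g1]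
  have hden : (y + z) * s ^ 2 - 2 * (y * z) * s + 3 * (y * z) = s * (3 * s ^ 2 - 2 * (y + z) * s - -(y * z)) := by
    linear_combination (-3 : ℝ) * hsex'
  have core := tendsto_stripZ₂_one_parity_of_decomposition hy hz hd0 hPF hEc hUc hVc
  rw [← hiq] at core
  have core0 := core 0
  simp only [add_zero, pow_zero, mul_one, zero_add] at core0
  rw [g4, g2, g0] at core0
  rw [← hu0, ← hu2, ← hu4, hden]
  convert core0 using 2
  congr 1
  linear_combination u0 * hsex'

set_option maxHeartbeats 400000 in
/-- ★★★ **Odd-length amplitude of the two-fugacity one-cell strip**: for all `y, z > 0`,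
`C_{1,2M+1}(y,z) / μ_1(y,z)^{2M+1} → A₁(y,z) = s·(U₁ s² + U₃ s + U₅) / (((y−z)² + 2y + 2z + 1)²·μ·((y+z)s² − 2yz·s + 3yz))`,
`μ = μ_1(y,z)`, `s = μ²`.  For `y ≠ z` the two amplitudes differ in general (`(y,z) = (2,1)`: `A₀ ≈ 18.842`, `A₁ ≈ 18.213`, kit), so
`C_{1,N}(y,z)/μ_1(y,z)^N` OSCILLATES with period `2` and has no limit — both `x = ±μ_1(y,z)^{-1}` are poles of the rational series; at `z = y` the
numerator vanishes at `x = −μ^{-1}` and the two amplitudes merge (`HexSAWBrickWallStripFugacityWidthOneAmplitude.lean`).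
[cite: BeatonBousquetMelouDeGierDuminilCopinGuttmann2014, §3.2 (arXiv v5 p. 10: C_{T,N}(y,z), Proposition 6: μ_T(y,z); p. 12); MadrasSlade1993, §1.1 eq. (1.1.4) p. 5, §8.5 Notes pp. 278–279; AlmJanson1990; Stanley2012EC1, §4.1 (Theorem 4.1.1 (iii))] -/
theorem tendsto_stripZ₂_one_odd_div_pow (hy : 0 < y) (hz : 0 < z) :
    Tendsto (fun M => stripZ₂ 1 (2 * M + 1) y z / stripMuY₂ 1 y z ^ (2 * M + 1)) atTop
      (𝓝 (stripMuY₂ 1 y z ^ 2 * ((4 + 16 * z + 36 * z ^ 2 + 44 * z ^ 3 + 24 * z ^ 4 + 4 * z ^ 5 + 16 * y + 148 * y * z + 124 * y * z ^ 2 + 12 * y * z ^ 3 - 12 * y * z ^ 4 + 36 * y ^ 2 + 124 * y ^ 2 * z - 72 * y ^ 2 * z ^ 2 + 8 * y ^ 2 * z ^ 3 + 44 * y ^ 3 + 12 * y ^ 3 * z + 8 * y ^ 3 * z ^ 2 + 24 * y ^ 4 - 12 * y ^ 4 * z + 4 * y ^ 5) * (stripMuY₂ 1 y z ^ 2) ^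 2 + (4 * z ^ 2 + 4 * z ^ 3 - 4 * z ^ 4 - 4 * z ^ 5 + 52 * y * z - 16 * y * z ^ 2 - 44 * y * z ^ 3 - 8 * y * z ^ 4 + 4 * y ^ 2 - 16 * y ^ 2 * z - 96 * y ^ 2 * z ^ 2 + 12 * y ^ 2 * z ^ 3 + 4 * y ^ 3 - 44 * y ^ 3 * z + 12 * y ^ 3 * z ^ 2 - 4 * y ^ 4 - 8 * y ^ 4 * z - 4 * y ^ 5) * stripMuY₂ 1 y z ^ 2 + (24 * y * z + 36 * y * z ^ 2 + 32 * y * z ^ 3 + 20 * y * z ^ 4 + 36 * y ^ 2 * z + 128 * y ^ 2 * z ^ 2 - 20 * y ^ 2 * z ^ 3 + 32 * y ^ 3 * z - 20 * y ^ 3 * z ^ 2 + 20 * y ^ 4 * z))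
        / (((y - z) ^ 2 + 2 * y + 2 * z + 1) ^ 2 * stripMuY₂ 1 y z * ((y + z) * (stripMuY₂ 1 y z ^ 2) ^ 2 - 2 * (y * z) * stripMuY₂ 1 y z ^ 2 + 3 * (y * z))))) := by
  set μ := stripMuY₂ 1 y z with hμdef
  have hμ : 0 < μ := stripMuY₂_pos 1 hy hz
  have hμ0 : μ ≠ 0 := hμ.ne'
  set s := μ ^ 2 with hsdef
  have hs : 0 < s := by positivity
  have hsex : s * (s - y) * (s - z) = y * z := stripMuY₂_one_sq_poly_eq hy hz
  have hsex' : s ^ 3 = (y + z) * s ^ 2 - y * z * s + y * z := by linear_combination hsex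
  have hd0 : (((y - z) ^ 2 + 2 * y + 2 * z + 1) ^ 2 : ℝ) ≠ 0 := by positivity
  -- the sixteen coefficient polynomials of the partial-fraction decomposition (kit/pf3.py)
  obtain ⟨e0, he0⟩ : ∃ r : ℝ, r = 2 + 7 * z + 8 * z ^ 2 + 2 * z ^ 3 - 2 * z ^ 4 - z ^ 5 + 7 * y - 18 * y * z ^ 2 - 8 * y * z ^ 3 + 3 * y * z ^ 4 + 8 * y ^ 2 - 18 * y ^ 2 * z + 20 * y ^ 2 * z ^ 2 - 2 * y ^ 2 * z ^ 3 + 2 * y ^ 3 - 8 * y ^ 3 * z - 2 * y ^ 3 * z ^ 2 - 2 * y ^ 4 + 3 * y ^ 4 * z - y ^ 5 := ⟨_, rfl⟩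
  obtain ⟨e1, he1⟩ : ∃ r : ℝ, r = -2 - 8 * z - 12 * z ^ 2 - 8 * z ^ 3 - 2 * z ^ 4 - 8 * y - 8 * y * z + 8 * y * z ^ 2 + 8 * y * z ^ 3 - 12 * y ^ 2 + 8 * y ^ 2 * z - 12 * y ^ 2 * z ^ 2 - 8 * y ^ 3 + 8 * y ^ 3 * z - 2 * y ^ 4 := ⟨_, rfl⟩
  obtain ⟨u0, hu0⟩ : ∃ r : ℝ, r = 4 + 46 * z + 58 * z ^ 2 + 28 * z ^ 3 + 14 * z ^ 4 + 2 * z ^ 5 + 46 * y + 80 * y * z + 44 * y * z ^ 2 - 4 * y * z ^ 3 - 6 * y * z ^ 4 + 58 * y ^ 2 + 44 * y ^ 2 * z - 20 * y ^ 2 * z ^ 2 + 4 * y ^ 2 * z ^ 3 + 28 * y ^ 3 - 4 * y ^ 3 * z + 4 * y ^ 3 * z ^ 2 + 14 * y ^ 4 - 6 * y ^ 4 * z + 2 * y ^ 5 := ⟨_, rfl⟩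
  obtain ⟨u1, hu1⟩ : ∃ r : ℝ, r = 4 + 16 * z + 36 * z ^ 2 + 44 * z ^ 3 + 24 * z ^ 4 + 4 * z ^ 5 + 16 * y + 148 * y * z + 124 * y * z ^ 2 + 12 * y * z ^ 3 - 12 * y * z ^ 4 + 36 * y ^ 2 + 124 * y ^ 2 * z - 72 * y ^ 2 * z ^ 2 + 8 * y ^ 2 * z ^ 3 + 44 * y ^ 3 + 12 * y ^ 3 * z + 8 * y ^ 3 * z ^ 2 + 24 * y ^ 4 - 12 * y ^ 4 * z + 4 * y ^ 5 := ⟨_, rfl⟩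
  obtain ⟨u2, hu2⟩ : ∃ r : ℝ, r = 10 * z - 4 * z ^ 2 - 6 * z ^ 3 + 8 * z ^ 4 + 10 * y - 12 * y * z + 4 * y * z ^ 2 - 36 * y * z ^ 3 - 26 * y * z ^ 4 - 4 * y * z ^ 5 - 4 * y ^ 2 + 4 * y ^ 2 * z - 88 * y ^ 2 * z ^ 2 + 26 * y ^ 2 * z ^ 3 + 16 * y ^ 2 * z ^ 4 - 6 * y ^ 3 - 36 * y ^ 3 * z + 26 * y ^ 3 * z ^ 2 - 24 * y ^ 3 * z ^ 3 + 8 * y ^ 4 - 26 * y ^ 4 * z + 16 * y ^ 4 * z ^ 2 - 4 * y ^ 5 * z := ⟨_, rfl⟩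
  obtain ⟨u3, hu3⟩ : ∃ r : ℝ, r = 4 * z ^ 2 + 4 * z ^ 3 - 4 * z ^ 4 - 4 * z ^ 5 + 52 * y * z - 16 * y * z ^ 2 - 44 * y * z ^ 3 - 8 * y * z ^ 4 + 4 * y ^ 2 - 16 * y ^ 2 * z - 96 * y ^ 2 * z ^ 2 + 12 * y ^ 2 * z ^ 3 + 4 * y ^ 3 - 44 * y ^ 3 * z + 12 * y ^ 3 * z ^ 2 - 4 * y ^ 4 - 8 * y ^ 4 * z - 4 * y ^ 5 := ⟨_, rfl⟩
  obtain ⟨u4, hu4⟩ : ∃ r : ℝ, r = 2 * z - 4 * z ^ 3 + 2 * z ^ 5 + 2 * y + 8 * y * z + 78 * y * z ^ 2 + 56 * y * z ^ 3 + 20 * y * z ^ 4 + 4 * y * z ^ 5 + 78 * y ^ 2 * z + 32 * y ^ 2 * z ^ 2 - 22 * y ^ 2 * z ^ 3 - 16 * y ^ 2 * z ^ 4 - 4 * y ^ 3 + 56 * y ^ 3 * z - 22 * y ^ 3 * z ^ 2 + 24 * y ^ 3 * z ^ 3 + 20 * y ^ 4 * z - 16 * y ^ 4 * z ^ 2 +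 2 * y ^ 5 + 4 * y ^ 5 * z := ⟨_, rfl⟩
  obtain ⟨u5, hu5⟩ : ∃ r : ℝ, r = 24 * y * z + 36 * y * z ^ 2 + 32 * y * z ^ 3 + 20 * y * z ^ 4 + 36 * y ^ 2 * z + 128 * y ^ 2 * z ^ 2 - 20 * y ^ 2 * z ^ 3 + 32 * y ^ 3 * z - 20 * y ^ 3 * z ^ 2 + 20 * y ^ 4 * z := ⟨_, rfl⟩
  obtain ⟨v0, hv0⟩ : ∃ r : ℝ, r = -4 - 44 * z - 50 * z ^ 2 - 16 * z ^ 3 - 6 * z ^ 4 - 44 * y - 64 * y * z - 24 * y * z ^ 2 + 4 * y * z ^ 3 - 50 * y ^ 2 - 24 * y ^ 2 * z + 4 * y ^ 2 * z ^ 2 - 16 * y ^ 3 + 4 * y ^ 3 * z - 6 * y ^ 4 := ⟨_, rfl⟩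
  obtain ⟨v1, hv1⟩ : ∃ r : ℝ, r = 4 * z + 4 * z ^ 2 - 4 * z ^ 3 - 4 * z ^ 4 + 4 * y - 100 * y * z - 100 * y * z ^ 2 - 28 * y * z ^ 3 + 4 * y ^ 2 - 100 * y ^ 2 * z + 64 * y ^ 2 * z ^ 2 - 4 * y ^ 3 - 28 * y ^ 3 * z - 4 * y ^ 4 := ⟨_, rfl⟩
  obtain ⟨v2, hv2⟩ : ∃ r : ℝ, r = -8 * z - 16 * z ^ 2 - 8 * z ^ 3 - 8 * y - 32 * y * z - 74 * y * z ^ 2 - 28 * y * z ^ 3 - 10 * y * z ^ 4 - 16 * y ^ 2 - 74 * y ^ 2 * z - 24 * y ^ 2 * z ^ 2 + 10 * y ^ 2 * z ^ 3 - 8 * y ^ 3 - 28 * y ^ 3 * z + 10 * y ^ 3 * z ^ 2 - 10 * y ^ 4 * z := ⟨_, rfl⟩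
  obtain ⟨v3, hv3⟩ : ∃ r : ℝ, r = -44 * y * z - 80 * y * z ^ 2 - 60 * y * z ^ 3 - 24 * y * z ^ 4 - 80 * y ^ 2 * z - 104 * y ^ 2 * z ^ 2 + 24 * y ^ 2 * z ^ 3 - 60 * y ^ 3 * z + 24 * y ^ 3 * z ^ 2 - 24 * y ^ 4 * z := ⟨_, rfl⟩
  obtain ⟨v4, hv4⟩ : ∃ r : ℝ, r = 8 * y * z + 42 * y * z ^ 2 + 36 * y * z ^ 3 + 10 * y * z ^ 4 + 8 * y * z ^ 5 + 42 * y ^ 2 * z + 12 * y ^ 2 * z ^ 2 + 30 * y ^ 2 * z ^ 3 - 12 * y ^ 2 * z ^ 4 + 36 * y ^ 3 * z + 30 * y ^ 3 * z ^ 2 + 8 * y ^ 3 * z ^ 3 + 10 * y ^ 4 * z - 12 * y ^ 4 * z ^ 2 + 8 * y ^ 5 * z := ⟨_, rfl⟩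
  obtain ⟨v5, hv5⟩ : ∃ r : ℝ, r = -4 * y * z - 12 * y * z ^ 2 - 4 * y * z ^ 3 + 12 * y * z ^ 4 + 8 * y * z ^ 5 - 12 * y ^ 2 * z + 92 * y ^ 2 * z ^ 2 + 76 * y ^ 2 * z ^ 3 + 4 * y ^ 2 * z ^ 4 - 4 * y ^ 3 * z + 76 * y ^ 3 * z ^ 2 - 24 * y ^ 3 * z ^ 3 + 12 * y ^ 4 * z + 4 * y ^ 4 * z ^ 2 + 8 * y ^ 5 * z := ⟨_, rfl⟩
  obtain ⟨v6, hv6⟩ : ∃ r : ℝ, r = -8 * y * z ^ 3 - 16 * y * z ^ 4 - 8 * y * z ^ 5 - 12 * y ^ 2 * z ^ 2 + 42 * y ^ 2 * z ^ 3 + 32 * y ^ 2 * z ^ 4 + 10 * y ^ 2 * z ^ 5 - 8 * y ^ 3 * z + 42 * y ^ 3 * z ^ 2 + 32 * y ^ 3 * z ^ 3 - 10 * y ^ 3 * z ^ 4 - 16 * y ^ 4 * z + 32 * y ^ 4 * z ^ 2 - 10 * y ^ 4 * z ^ 3 - 8 * y ^ 5 * z + 10 * y ^ 5 * z ^ 2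 := ⟨_, rfl⟩
  obtain ⟨v7, hv7⟩ : ∃ r : ℝ, r = 24 * y ^ 2 * z ^ 2 + 36 * y ^ 2 * z ^ 3 + 32 * y ^ 2 * z ^ 4 + 20 * y ^ 2 * z ^ 5 + 36 * y ^ 3 * z ^ 2 + 128 * y ^ 3 * z ^ 3 - 20 * y ^ 3 * z ^ 4 + 32 * y ^ 4 * z ^ 2 - 20 * y ^ 4 * z ^ 3 + 20 * y ^ 5 * z ^ 2 := ⟨_, rfl⟩
  have hPF : C (((y - z) ^ 2 + 2 * y + 2 * z + 1) ^ 2) * twoWallP y z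
      = (C e0 + C e1 * X) * (((1 - C y * X ^ 2) * (1 - C z * X ^ 2) - C y * C z * X ^ 6) * (1 - C y * C z * X ^ 4) ^ 2)
      + (C u0 + C u1 * X + C u2 * X ^ 2 + C u3 * X ^ 3 + C u4 * X ^ 4 + C u5 * X ^ 5) * (1 - C y * C z * X ^ 4) ^ 2
      + (C v0 + C v1 * X + C v2 * X ^ 2 + C v3 * X ^ 3 + C v4 * X ^ 4 + C v5 * X ^ 5 + C v6 * X ^ 6 + C v7 * X ^ 7) * ((1 - C y * X ^ 2) * (1 - C z * X ^ 2) - C y * C z * X ^ 6) := by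
    rw [he0, he1, hu0, hu1, hu2, hu3, hu4, hu5, hv0, hv1, hv2, hv3, hv4, hv5, hv6, hv7]
    simp only [twoWallP, map_add, map_sub, map_mul, map_pow, map_neg, map_ofNat, map_one]
    ring
  have hEc : ∀ N, coeff (N + 2) (C e0 + C e1 * X) = 0 := by
    intro N
    simp only [map_add, PowerSeries.coeff_C_mul, PowerSeries.coeff_C, coeff_X, Nat.reduceEqDiff, if_false,
      mul_zero, add_zero]
  have hUc : ∀ N, coeff (N + 6) (C u0 + C u1 * X + C u2 * X ^ 2 + C u3 * X ^ 3 + C u4 * X ^ 4 + C u5 * X ^ 5) = 0 := by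
    intro N
    simp only [map_add, PowerSeries.coeff_C_mul, PowerSeries.coeff_C, coeff_X, PowerSeries.coeff_X_pow,
      Nat.reduceEqDiff, if_false, mul_zero, add_zero]
  have hVc : ∀ N, coeff (N + 8) (C v0 + C v1 * X + C v2 * X ^ 2 + C v3 * X ^ 3 + C v4 * X ^ 4 + C v5 * X ^ 5 + C v6 * X ^ 6 + C v7 * X ^ 7) = 0 := by
    intro N
    simp only [map_add, PowerSeries.coeff_C_mul, PowerSeries.coeff_C, coeff_X, PowerSeries.coeff_X_pow,
      Nat.reduceEqDiff, if_false, mul_zero, add_zero]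
  -- the initial coefficients of `U/q(X²)`
  obtain ⟨iq, hiq⟩ : ∃ iq : ℝ⟦X⟧, iq = PowerSeries.invOfUnit ((1 - C y * X ^ 2) * (1 - C z * X ^ 2) - C y * C z * X ^ 6) 1 := ⟨_, rfl⟩
  have hqinv : ((1 - C y * X ^ 2) * (1 - C z * X ^ 2) - C y * C z * X ^ 6) * iq = 1 := by
    rw [hiq]; exact PowerSeries.mul_invOfUnit _ 1 (by simp)
  have hUiq : (C u0 + C u1 * X + C u2 * X ^ 2 + C u3 * X ^ 3 + C u4 * X ^ 4 + C u5 * X ^ 5) * iq * ((1 - C y * X ^ 2) * (1 - C z * X ^ 2) - C y * C z * X ^ 6)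
      = (C u0 + C u1 * X + C u2 * X ^ 2 + C u3 * X ^ 3 + C u4 * X ^ 4 + C u5 * X ^ 5) := by
    rw [mul_assoc, mul_comm iq, hqinv, mul_one]
  obtain ⟨h0, h1, h2, h3, h4, h5⟩ := coeff_init_six hUiq
  have cU0 : coeff 0 (C u0 + C u1 * X + C u2 * X ^ 2 + C u3 * X ^ 3 + C u4 * X ^ 4 + C u5 * X ^ 5) = u0 := by
    simp only [map_add, PowerSeries.coeff_C_mul, PowerSeries.coeff_C, coeff_X, PowerSeries.coeff_X_pow]; norm_num
  have cU1 : coeff 1 (C u0 + C u1 * X + C u2 * X ^ 2 + C u3 * X ^ 3 + C u4 * X ^ 4 + C u5 * X ^ 5) = u1 := by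
    simp only [map_add, PowerSeries.coeff_C_mul, PowerSeries.coeff_C, coeff_X, PowerSeries.coeff_X_pow]; norm_num
  have cU2 : coeff 2 (C u0 + C u1 * X + C u2 * X ^ 2 + C u3 * X ^ 3 + C u4 * X ^ 4 + C u5 * X ^ 5) = u2 := by
    simp only [map_add, PowerSeries.coeff_C_mul, PowerSeries.coeff_C, coeff_X, PowerSeries.coeff_X_pow]; norm_num
  have cU3 : coeff 3 (C u0 + C u1 * X + C u2 * X ^ 2 + C u3 * X ^ 3 + C u4 * X ^ 4 + C u5 * X ^ 5) = u3 := by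
    simp only [map_add, PowerSeries.coeff_C_mul, PowerSeries.coeff_C, coeff_X, PowerSeries.coeff_X_pow]; norm_num
  have cU4 : coeff 4 (C u0 + C u1 * X + C u2 * X ^ 2 + C u3 * X ^ 3 + C u4 * X ^ 4 + C u5 * X ^ 5) = u4 := by
    simp only [map_add, PowerSeries.coeff_C_mul, PowerSeries.coeff_C, coeff_X, PowerSeries.coeff_X_pow]; norm_num
  have cU5 : coeff 5 (C u0 + C u1 * X + C u2 * X ^ 2 + C u3 * X ^ 3 + C u4 * X ^ 4 + C u5 * X ^ 5) = u5 := by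
    simp only [map_add, PowerSeries.coeff_C_mul, PowerSeries.coeff_C, coeff_X, PowerSeries.coeff_X_pow]; norm_num
  have g0 : coeff 0 ((C u0 + C u1 * X + C u2 * X ^ 2 + C u3 * X ^ 3 + C u4 * X ^ 4 + C u5 * X ^ 5) * iq) = u0 := by rw [h0, cU0]
  have g1 : coeff 1 ((C u0 + C u1 * X + C u2 * X ^ 2 + C u3 * X ^ 3 + C u4 * X ^ 4 + C u5 * X ^ 5) * iq) = u1 := by rw [h1, cU1]
  have g2 : coeff 2 ((C u0 + C u1 * X + C u2 * X ^ 2 + C u3 * X ^ 3 + C u4 * X ^ 4 + C u5 * X ^ 5) * iq) = u2 + (y + z) * u0 := by rw [h2, cU2, g0]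
  have g3 : coeff 3 ((C u0 + C u1 * X + C u2 * X ^ 2 + C u3 * X ^ 3 + C u4 * X ^ 4 + C u5 * X ^ 5) * iq) = u3 + (y + z) * u1 := by rw [h3, cU3, g1]
  have g4 : coeff 4 ((C u0 + C u1 * X + C u2 * X ^ 2 + C u3 * X ^ 3 + C u4 * X ^ 4 + C u5 * X ^ 5) * iq) = u4 + (y + z) * (u2 + (y + z) * u0) - y * z * u0 := by rw [h4, cU4, g2, g0]
  have g5 : coeff 5 ((C u0 + C u1 * X + C u2 * X ^ 2 + C u3 * X ^ 3 + C u4 * X ^ 4 + C u5 * X ^ 5) * iq) = u5 + (y + z) * (u3 + (y + z) * u1) - y * z * u1 := by rw [h5, cU5, g3, g1]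
  have hden : (y + z) * s ^ 2 - 2 * (y * z) * s + 3 * (y * z) = s * (3 * s ^ 2 - 2 * (y + z) * s - -(y * z)) := by
    linear_combination (-3 : ℝ) * hsex'
  have core := tendsto_stripZ₂_one_parity_of_decomposition hy hz hd0 hPF hEc hUc hVc
  rw [← hiq] at core
  have core1 := core 1
  simp only [pow_one] at core1
  rw [show (1 : ℕ) + 4 = 5 by norm_num, show (1 : ℕ) + 2 = 3 by norm_num] at core1
  rw [g5, g3, g1] at core1
  rw [← hu1, ← hu3, ← hu5, hden]
  convert core1 using 2
  congr 1
  linear_combination u1 * hsex'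


/-- Every parity limit of `C_{1,2M+c}(y,z)/μ_1(y,z)^{2M+c}` is positive: Fekete's inequality `μ_1^N ≤ K(y)K(z)·C_{1,N}` bounds the
quotients below by `1/(K(y)K(z)) > 0`. [cite: BeatonBousquetMelouDeGierDuminilCopinGuttmann2014, §3.2 Proposition 6 (arXiv v5 p. 10)] -/
theorem pos_of_tendsto_stripZ₂_one_parity (hy : 0 < y) (hz : 0 < z) (c : ℕ) {A : ℝ}
    (h : Tendsto (fun M => stripZ₂ 1 (2 * M + c) y z / stripMuY₂ 1 y z ^ (2 * M + c)) atTop (𝓝 A)) : 0 < A := by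
  have hμ : 0 < stripMuY₂ 1 y z := stripMuY₂_pos 1 hy hz
  have hK : 0 < yK y * yK z := mul_pos (by linarith [one_le_yK y]) (by linarith [one_le_yK z])
  have hlow : 1 / (yK y * yK z) ≤ A := by
    refine ge_of_tendsto h ?_
    filter_upwards [eventually_ge_atTop 1] with M hM
    have hN : 2 * M + c ≠ 0 := by omega
    have hle := stripMuY₂_one_pow_le hy hz hN
    rw [div_le_div_iff₀ hK (pow_pos hμ _)]
    linarith
  exact lt_of_lt_of_le (by positivity) hlow

/-- ★★ **`γ = 1`, parity by parity, for all `y, z > 0`**: there are amplitudes `A₀, A₁ > 0` with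
`C_{1,2M}(y,z)/μ_1(y,z)^{2M} → A₀` and `C_{1,2M+1}(y,z)/μ_1(y,z)^{2M+1} → A₁` (the explicit values are
`tendsto_stripZ₂_one_even_div_pow` / `tendsto_stripZ₂_one_odd_div_pow`).
[cite: MadrasSlade1993, §1.1 eq. (1.1.4) p. 5, §8.5 Notes pp. 278–279 (γ(R) = 1: Klein 1980, Alm–Janson 1990); AlmJanson1990; BeatonBousquetMelouDeGierDuminilCopinGuttmann2014, §3.2 (arXiv v5 p. 10)] -/
theorem exists_stripZ₂_one_parity_amplitudes (hy : 0 < y) (hz : 0 < z) :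
    ∃ A₀ A₁ : ℝ, 0 < A₀ ∧ 0 < A₁ ∧
      Tendsto (fun M => stripZ₂ 1 (2 * M) y z / stripMuY₂ 1 y z ^ (2 * M)) atTop (𝓝 A₀) ∧
      Tendsto (fun M => stripZ₂ 1 (2 * M + 1) y z / stripMuY₂ 1 y z ^ (2 * M + 1)) atTop (𝓝 A₁) := by
  have h0 := tendsto_stripZ₂_one_even_div_pow hy hz
  have h1 := tendsto_stripZ₂_one_odd_div_pow hy hz
  exact ⟨_, _, pos_of_tendsto_stripZ₂_one_parity hy hz 0 h0, pos_of_tendsto_stripZ₂_one_parity hy hz 1 h1, h0, h1⟩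

/-- From a positive parity limit to the two-step ratio along that parity. [cite: MadrasSlade1993, §8.5 Notes pp. 278–279 (γ(R) = 1)] -/
private theorem ratio_two_of_parity_limit (hy : 0 < y) (hz : 0 < z) (c : ℕ) {A : ℝ}
    (h : Tendsto (fun M => stripZ₂ 1 (2 * M + c) y z / stripMuY₂ 1 y z ^ (2 * M + c)) atTop (𝓝 A)) :
    Tendsto (fun M => stripZ₂ 1 (2 * (M + 1) + c) y z / stripZ₂ 1 (2 * M + c) y z) atTop
      (𝓝 (stripMuY₂ 1 y z ^ 2)) := by
  set μ := stripMuY₂ 1 y z with hμdef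
  have hμ : 0 < μ := stripMuY₂_pos 1 hy hz
  have hA := pos_of_tendsto_stripZ₂_one_parity hy hz c h
  have hq := ((h.comp (tendsto_add_atTop_nat 1)).div h hA.ne').mul_const (μ ^ 2)
  rw [div_self hA.ne', one_mul] at hq
  refine hq.congr' ?_
  filter_upwards [h.eventually_ne hA.ne'] with M hM
  have hZ : stripZ₂ 1 (2 * M + c) y z ≠ 0 := by
    intro h0; exact hM (by rw [h0, zero_div])
  have hμn : μ ^ (2 * M + c) ≠ 0 := pow_ne_zero _ hμ.ne'
  simp only [Function.comp_apply, Pi.div_apply]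
  rw [show 2 * (M + 1) + c = 2 * M + c + 2 by ring, pow_add]
  field_simp

/-- ★★ **Two-step ratio law** (the Kesten-type ratio for the weighted strip): for all `y, z > 0`,
`C_{1,N+2}(y,z) / C_{1,N}(y,z) → μ_1(y,z)²` as `N → ∞` (while `C_{1,N+1}/C_{1,N}` has the two limit points
`μ·A₁/A₀` and `μ·A₀/A₁` when `y ≠ z`). [cite: MadrasSlade1993, §8.5 Notes pp. 278–279 (γ(R) = 1); BeatonBousquetMelouDeGierDuminilCopinGuttmann2014, §3.2 Proposition 6 (arXiv v5 p. 10: μ_T(y,z) = lim C_{T,n}(y,z)^{1/n})] -/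
theorem tendsto_stripZ₂_one_ratio_two (hy : 0 < y) (hz : 0 < z) :
    Tendsto (fun N => stripZ₂ 1 (N + 2) y z / stripZ₂ 1 N y z) atTop (𝓝 (stripMuY₂ 1 y z ^ 2)) := by
  have h0 := tendsto_stripZ₂_one_even_div_pow hy hz
  have h1 := tendsto_stripZ₂_one_odd_div_pow hy hz
  have r0 := ratio_two_of_parity_limit hy hz 0 h0
  have r1 := ratio_two_of_parity_limit hy hz 1 h1
  -- combine the two residue classes mod 2
  set g : ℕ → ℝ := fun N => stripZ₂ 1 (N + 2) y z / stripZ₂ 1 N y z - stripMuY₂ 1 y z ^ 2 with hg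
  have hbase : ∀ r, r < 2 → Tendsto (fun M => g (2 * M + r)) atTop (𝓝 0) := by
    intro r hr
    interval_cases r
    · have := r0.sub_const (stripMuY₂ 1 y z ^ 2)
      rw [sub_self] at this
      refine this.congr fun M => ?_
      simp only [hg]; ring_nf
    · have := r1.sub_const (stripMuY₂ 1 y z ^ 2)
      rw [sub_self] at this
      refine this.congr fun M => ?_
      simp only [hg]; ring_nf
  have hall : ∀ c, Tendsto (fun k => g (2 * k + c)) atTop (𝓝 0) := by
    intro c
    have hc : c = 2 * (c / 2) + c % 2 := (Nat.div_add_mod c 2).symm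
    have h := (hbase (c % 2) (Nat.mod_lt c two_pos)).comp (tendsto_add_atTop_nat (c / 2))
    refine h.congr fun k => ?_
    simp only [Function.comp_apply]
    congr 1
    omega
  have hg0 := tendsto_zero_of_residues two_pos hall
  have := hg0.add_const (stripMuY₂ 1 y z ^ 2)
  rw [zero_add] at this
  refine this.congr fun N => ?_
  simp only [hg]
  ring


/-- ★★ **No amplitude for unequal walls — a concrete witness.**  For `(y, z) = (2, 1)` the normalised partition function
`C_{1,N}(2,1)/μ_1(2,1)^N` does NOT converge: its even and odd subsequences have the different limits `A₀(2,1) > A₁(2,1)`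
(`μ_1(2,1)² = s` with `s(s−2)(s−1) = 2`, `2.521 < s < 2.522`; `A₀/A₁ = μ(1232s² − 784s + 1312)/(1920s² − 960s + 1216) ≈ 1.0345`).
So `γ = 1` holds parity by parity but Madras–Slade's form `c_N ∼ A μ^N` ((1.1.4) with `γ = 1`) FAILS for this weighted model.
[cite: MadrasSlade1993, §1.1 eq. (1.1.4) p. 5 (c_N ∼ Aμ^N N^{γ−1}); BeatonBousquetMelouDeGierDuminilCopinGuttmann2014, §3.2 (arXiv v5 p. 10: C_{T,N}(y,z))] -/
theorem not_tendsto_stripZ₂_one_two_one :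
    ¬ ∃ A : ℝ, Tendsto (fun N => stripZ₂ 1 N 2 1 / stripMuY₂ 1 2 1 ^ N) atTop (𝓝 A) := by
  rintro ⟨A, hA⟩
  have hy : (0 : ℝ) < 2 := by norm_num
  have hz : (0 : ℝ) < 1 := by norm_num
  have h0 := tendsto_stripZ₂_one_even_div_pow hy hz
  have h1 := tendsto_stripZ₂_one_odd_div_pow hy hz
  -- the subsequences of the putative limit
  have h2M : Tendsto (fun M : ℕ => 2 * M) atTop atTop := tendsto_atTop_atTop.2 fun B => ⟨B, fun M hM => by omega⟩
  have h2M1 : Tendsto (fun M : ℕ => 2 * M + 1) atTop atTop := tendsto_atTop_atTop.2 fun B => ⟨B, fun M hM => by omega⟩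
  have e0 := tendsto_nhds_unique (hA.comp h2M) h0
  have e1 := tendsto_nhds_unique (hA.comp h2M1) h1
  rw [e0] at e1
  -- the numbers
  set μ := stripMuY₂ 1 (2 : ℝ) 1 with hμdef
  have hμ : 0 < μ := stripMuY₂_pos 1 hy hz
  set s := μ ^ 2 with hsdef
  have hsex : s * (s - 2) * (s - 1) = 2 * 1 := stripMuY₂_one_sq_poly_eq hy hz
  have hmax : max (2 : ℝ) 1 < s := max_lt_stripMuY₂_one_sq hy hz
  have hs2 : 2 < s := lt_of_le_of_lt (le_max_left _ _) hmax
  have hslo : 2.521 < s := by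
    by_contra h
    rw [not_lt] at h
    rcases h.lt_or_eq with h | h
    · have := poly_lt_poly_of_lt (y := (2 : ℝ)) (z := 1) hmax.le h hy
      rw [hsex] at this
      norm_num at this
    · rw [h] at hsex; norm_num at hsex
  have hshi : s < 2.522 := by
    by_contra h
    rw [not_lt] at h
    rcases h.lt_or_eq with h | h
    · have := poly_lt_poly_of_lt (y := (2 : ℝ)) (z := 1) (by norm_num : max (2 : ℝ) 1 ≤ 2.522) h hy
      rw [hsex] at this
      norm_num at this
    · rw [← h] at hsex; norm_num at hsex
  norm_num at e1
  -- `e1 : A₀(2,1) = A₁(2,1)`; clear denominators and compare squares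
  have hD : 0 < 3 * s ^ 2 - 4 * s + 6 := by nlinarith
  have hN0 : 7165 < 1232 * s ^ 2 - 784 * s + 1312 := by nlinarith
  have hN1 : 1920 * s ^ 2 - 960 * s + 1216 < 11008 := by nlinarith
  have hN1' : 0 < 1920 * s ^ 2 - 960 * s + 1216 := by nlinarith
  have hs0 : 0 < s := by positivity
  rw [div_eq_div_iff (by positivity) (by positivity)] at e1
  have h64 : (0 : ℝ) < 64 * s * (3 * s ^ 2 - 4 * s + 6) := by positivity
  have key : μ * (1232 * s ^ 2 - 784 * s + 1312) = 1920 * s ^ 2 - 960 * s + 1216 := by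
    apply mul_left_cancel₀ h64.ne'
    linear_combination e1
  have hsq : (μ * (1232 * s ^ 2 - 784 * s + 1312)) ^ 2 = (1920 * s ^ 2 - 960 * s + 1216) ^ 2 := by rw [key]
  rw [mul_pow, ← hsdef] at hsq
  have h1 : (7165 : ℝ) ^ 2 < (1232 * s ^ 2 - 784 * s + 1312) ^ 2 := by nlinarith
  have h2 : (2.521 : ℝ) * 7165 ^ 2 < s * (1232 * s ^ 2 - 784 * s + 1312) ^ 2 := by nlinarith
  have h3 : (1920 * s ^ 2 - 960 * s + 1216) ^ 2 < (11008 : ℝ) ^ 2 := by nlinarith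
  nlinarith


/-- ★★ **One attractive wall** (`z = 1`, the objects `C_{1,N}(y,1) = stripZ₀ 1 N y`, `μ_1(y,1) = stripMuY₀ 1 y` of
Beaton et al.'s Proposition 7), even lengths: for every `y > 0`,
`C_{1,2M}(y,1)/μ_1(y,1)^{2M} → s(U₀s² + U₂s + U₄)/((y²+4)²((y+1)s² − 2ys + 3y))`, `s = μ_1(y,1)²` (`s(s−y)(s−1) = y`), with
`U₀ = 152 + 160y + 86y² + 28y³ + 8y⁴ + 2y⁵`, `U₂ = 8 − 64y − 46y² − 40y³ − 2y⁴ − 4y⁵`, `U₄ = 168y + 72y² + 54y³ + 4y⁴ + 6y⁵`.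
[cite: BeatonBousquetMelouDeGierDuminilCopinGuttmann2014, §3.2 Proposition 7 (arXiv v5 p. 11: μ_T(y,1)); MadrasSlade1993, §1.1 eq. (1.1.4) p. 5; Stanley2012EC1, §4.1 (Theorem 4.1.1 (iii))] -/
theorem tendsto_stripZ₀_one_even_div_pow (hy : 0 < y) :
    Tendsto (fun M => stripZ₀ 1 (2 * M) y / stripMuY₀ 1 y ^ (2 * M)) atTop
      (𝓝 (stripMuY₀ 1 y ^ 2 * ((152 + 160 * y + 86 * y ^ 2 + 28 * y ^ 3 + 8 * y ^ 4 + 2 * y ^ 5) * (stripMuY₀ 1 y ^ 2) ^ 2 + (8 - 64 * y - 46 * y ^ 2 - 40 * y ^ 3 - 2 * y ^ 4 - 4 * y ^ 5) * stripMuY₀ 1 y ^ 2 + (168 * y + 72 * y ^ 2 + 54 * y ^ 3 + 4 * y ^ 4 + 6 * y ^ 5))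
        / ((y ^ 2 + 4) ^ 2 * ((y + 1) * (stripMuY₀ 1 y ^ 2) ^ 2 - 2 * y * stripMuY₀ 1 y ^ 2 + 3 * y)))) := by
  have h := tendsto_stripZ₂_one_even_div_pow hy one_pos
  simp only [stripZ₂_one_right, stripMuY₂_one_right] at h
  convert h using 2
  ring

/-- ★★ **One attractive wall, odd lengths**: for every `y > 0`,
`C_{1,2M+1}(y,1)/μ_1(y,1)^{2M+1} → s(U₁s² + U₃s + U₅)/((y²+4)²·μ·((y+1)s² − 2ys + 3y))`, `μ = μ_1(y,1)`, `s = μ²`, with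
`U₁ = 128 + 288y + 96y² + 64y³ + 12y⁴ + 4y⁵`, `U₃ = −16y − 96y² − 28y³ − 12y⁴ − 4y⁵`, `U₅ = 112y + 144y² + 12y³ + 20y⁴`
(for `y ≠ 1` the even and odd amplitudes differ in general — `not_tendsto_stripZ₂_one_two_one` is the case `y = 2`).
[cite: BeatonBousquetMelouDeGierDuminilCopinGuttmann2014, §3.2 Proposition 7 (arXiv v5 p. 11: μ_T(y,1)); MadrasSlade1993, §1.1 eq. (1.1.4) p. 5; Stanley2012EC1, §4.1 (Theorem 4.1.1 (iii))] -/
theorem tendsto_stripZ₀_one_odd_div_pow (hy : 0 < y) :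
    Tendsto (fun M => stripZ₀ 1 (2 * M + 1) y / stripMuY₀ 1 y ^ (2 * M + 1)) atTop
      (𝓝 (stripMuY₀ 1 y ^ 2 * ((128 + 288 * y + 96 * y ^ 2 + 64 * y ^ 3 + 12 * y ^ 4 + 4 * y ^ 5) * (stripMuY₀ 1 y ^ 2) ^ 2 + (-(16 * y) - 96 * y ^ 2 - 28 * y ^ 3 - 12 * y ^ 4 - 4 * y ^ 5) * stripMuY₀ 1 y ^ 2 + (112 * y + 144 * y ^ 2 + 12 * y ^ 3 + 20 * y ^ 4))
        / ((y ^ 2 + 4) ^ 2 * stripMuY₀ 1 y * ((y + 1) * (stripMuY₀ 1 y ^ 2) ^ 2 - 2 * y * stripMuY₀ 1 y ^ 2 + 3 * y)))) := by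
  have h := tendsto_stripZ₂_one_odd_div_pow hy one_pos
  simp only [stripZ₂_one_right, stripMuY₂_one_right] at h
  convert h using 2
  ring

end amplitudes

end WidthOneYZ

end Literature.Probability.RandomPlanarGeometry.SAW.HexBW
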